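import Literature.MathematicalPhysics.QuantumFieldTheory.Balaban1983to89.B3Op116MixedSeedBox
import Literature.MathematicalPhysics.QuantumFieldTheory.Balaban1983to89.B3Op116MajorantStepBoxFar
import Literature.MathematicalPhysics.QuantumFieldTheory.Balaban1983to89.B3Op116DKernelRegularBox
import Literature.MathematicalPhysics.QuantumFieldTheory.Balaban1983to89.B3Op116MixedKernelRegularTorus
import Literature.MathematicalPhysics.QuantumFieldTheory.Balaban1983to89.B3Op116MixedKernelRegularRegion

/-!
# `Balaban1983to89.B3Op116MixedKernelRegularBox` — T. Bałaban, *(Higgs)₂,₃ quantum fields in a finite volume. III. Renormalization*,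
# Commun. Math. Phys. **88** (1983) 411–445 [Balaban1983Higgs3], (1.16) p. 414 / (2.5)–(2.6) p. 424 / (2.10) p. 426 / p. 433:
# **THE MIXED (DIPOLE–DIPOLE) ENTRY OF THE KERNEL OF (1.16) ON A `k`-BLOCK UNION `Ω` WITHOUT THE SUPPORT CLAUSE** — the dipole-seeded chain
# `D^ε_B(1.16)^Ω_{n,n′}dip^B_{b′}e_i` with BOTH ends one top block inside `Ω` is uniformly bounded and exponentially decaying for `n + n′ > d`:
# the seed M1 (`B3Op116MixedSeedBox`: the mixed seed with its face sheet), ONE far-anchored step M0 (`B3Op116MajorantStepBoxFar`: digests the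
# seed's sheet of exponent `1` by the margin of the source), then p35's box induction (`B3Op116DKernelRegularBox.step_fields_box`) and the end
# sheet resolved by the margin of the row point (file M2 of the mixed member `hM` of (2.5) for (1.16) on a box; p35 `DESIGN-FILE4.md` §19)

statement-level skeleton of published theorems with citation tags; proofs where landed; nothing here is a claim about the Yang–Mills mass gap

PDFs held: `paper:balaban1983-higgs-2-3-quantum-fields-finite-volume` (journal page = PDF page + 410; p. 414 = `p0004.txt`, p. 424 = `p0014.txt`,
p. 426 = `p0016.txt`, p. 433 = `p0023.txt`); `paper:balaban1982-cmp85-higgs23-i` (p. 610 = `p0008.txt`, p. 615 = `p0013.txt`, p. 619 = `p0017.txt`).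

CITATION HEADER (lean-in-tree rule).  T. Bałaban, CMP **88** (1983) 411–445 [Balaban1983Higgs3]: (1.16) p. 414, (2.5)/(2.6) p. 424, (2.10) p. 426,
p. 433; part I, CMP **85** (1982) 603–636 [Balaban1982Higgs1]: Prop. 2.1 (2.25) p. 610, (3.16) p. 615, (3.44) p. 619.  Cell `lit-balaban` (HOME
`run/shared/lean/pub/lit-balaban/`), Phase-2 proof seat **p35** gen 28 (literature-prover-lit-balaban-p35-g28-0; free-target protocol G.5-34(d),
TAKING HOME/STATUS.md, cc r15 / p40).  SKELETON rows **B3.Eq1.16** / **B3.Eq2.5** / **B3.Txt@433** / **B3.Prop1** (owner r15) — LOCATED MEMBER, no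
head claim: file M2 of route γ′'s mixed member (GAPS.md G-B3-16.A1).  USED BY NAME, never restated: M1 `B3Op116MixedSeedBox` (`mixed_seed_le_box`,
`value_W_dip_le_box`, `W_dip_apply_eq_zero_of_not_mem`, `W_apply_eq`, `dcolO_le_majorant`, `pcolO`/`pdcolO`/`pmixO`), M0 `B3Op116MajorantStepBoxFar`
(`face_conv_maj_le_far`, `faceKfar`, `stepBoxCfar`, `stepBoxVCfar`, `step_fields_box_far`), p35's `B3Op116DKernelRegularBox` (`BoxState`,
`step_fields_box`), p40's `B3Op116MixedKernelRegularTorus` (the seed constants `cvW`, `cdW` and their signs), r14's `B3Op116SourceForm` /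
`B3Eq116TwoSidedExpansion` (`op116`, `op116_zero_zero/succ_left/succ_right_apply`, (I.3.44) `eq344_model(_right)`, THEOREM A `opV_apply_eq_srcV` on
every `Ω`), p40's `B3Op116MixedKernelRegularRegion.GB_srcV_GB_eq_region` ((I.3.44) from the left on every `Ω` — v1.1: my restated copy
`GB_srcV_GB_eq_box` deleted after the gate's `dedup.landed` on p383434), p35's `B3Op116MajorantStep` (`maj`, `maj_exponent_reduce`, …), p33's
`B3Op116MajorantConvolution.majorant_le_top`.

WHAT IS PRINTED (verbatim).  p. 414 [PDF 4]: *"for n, n′ sufficiently large, a kernel of the operator (1.16) is a sufficiently regular function of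
both variables. More exactly the Hölder norms of the covariant derivatives of this kernel, the norms defined for example in the inequalities (I.2.24)
and (I.2.25) of Proposition I.2.1, are exponentially decaying with the distance of the arguments and are uniformly bounded by
O(1)(e(L^kε)^{1−α})^{n+n′}"*.  p. 433 [PDF 23]: *"we take a cube □ of size 3r(L^kε) and with □₁ in the center. We assume that □₁, □ are sums of
big blocks of the unit lattice. … we include the operators (1.16) … into the external fields"*.  [B1] Prop. 2.1 (2.25) p. 610 (the mixed Hölder
norm with one covariant derivative in each variable); (3.44) p. 619.

WHAT THIS FILE PROVES ((B)-level, every `Ω` that is a union of `l`-blocks for all `l ≤ k`).  HYPOTHESES: the per-piece (2.10) dictionaries of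
`G_k(Ω,B)` and `G_k(Ω,A+B)` on `Ω` (value / differentiated columns at bonds `⊂ Ω` / twice-differentiated kernels at pairs of bonds `⊂ Ω` — the
conclusion shapes of p35 g21's `B3Ineq210RegularBox.ineq210_regularBox_explicit_small` and `B3Ineq210MixedRegularBox.ineq210_mixed_regularBox`),
`sup|A_b| ≤ s`, `A` (I.2.23)-regular (`δ_A`), `(L^kε)|e|s ≤ 1`, `m² > 0`, `a > 0`, `1 ≤ k ≤ K`, `0 < δ₁ ≤ 1`, a face family `F_i ⊆ {u_{ν_i} = c_i}`
covering the ends in `Ω` of the charged bonds crossing `∂Ω`, and the two END POINTS — the dipole's `x′` and the row's `x` — at height `≥ θL^k` above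
every face level (`θ > 0`; one top block inside `□` in the (C)-plug).  NO support clause on `A`.
* §1 the constants: the seed triple-with-sheet `(δ_S; cvS, cdS, cSS)` of the mixed seed (M1, the value sheet at the source resolved by M0's
  `face_conv_maj_le_far`), its far step `(cv1, cd1)` (M0), the weakened seed `(cvD, cdD, cSD)` of the two inner seeds, and the recursion `seqM`
  (`0 ↦` weakened seed, `1 ↦` far step, `J + 2 ↦` p35's box step) with its signs `seqM_pos`;
  DEPENDENCIES OF THE CONSTANTS (the owner's (δ3)-style reading; r15 17:02:27Z).  Every constant of §1 — and `mixCB` — is an explicit expression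
  in: print's smallness parameters `|e|s` and `L^k|e|δ_A` (through p35's `kap4 = κ₄(|e|s, a_k)`, p40's `kapF = d((ε⁻¹|e|δ_A + ε⁻¹|e|s) + …)`, the
  torus seed constants `seedK1/seedK2` inside `cvW/cdW`), the (2.10) dictionary constants `C`, `C_M`, `δ₁` (hypotheses `hpcB … hpmAB`), the number of
  faces `n_F`, `#Ix`, `d`, `L`, `a_k`, `θ`, and the POWERS OF `ε` that fix the currency of the dictionaries (`pcolO ≤ ε^dC·…`, `cK = ε^dC`) and of
  the dipole basis (`ε⁻¹dip`, `shC = 4dε⁻¹|e|s`, `kapF`).  `k` enters only through `L^k|e|δ_A`, `(L^kε)|e|s ≤ 1`, `a_k` and those currency powers.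
  This file DISPLAYS the constants with bodies; it does NOT assert that the currency powers of `ε` cancel or that `mixCB` is uniform in `ε` or
  `k` — that bookkeeping is the head's reading of (2.5), outside this file (as for p40's torus `mixC`).
* §2 the per-piece dictionaries give the total-column dictionaries of the steps (`colO_le_maj`, M1's `dcolO_le_majorant`);
* §3 THE SEEDS: `W_dip_boxState` (`Wdip^B_{b′}e_i` is in the state `(2; δ_S; cvS, cdS, cSS)` of `B3Op116DKernelRegularBox.BoxState`),
  `GB_srcV_W_dip_bounds` (its far step), `GAB_srcV_GB_eq_box` ((I.3.44) from the right; (I.3.44) from the left is p40's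
  `B3Op116MixedKernelRegularRegion.GB_srcV_GB_eq_region`, USED BY NAME), **`seed_boxStateM`** (both inner seeds
  `G_k(Ω,X)V_k^ΩG_k(Ω,B)dip^B_{b′}e_i`, `X ∈ {B, A+B}`, in the state `0` of `seqM`);
* §4 THE INDUCTION: `step_boxStateM` (state `J ↦ J+1` along `seqM`: the far step at `J = 0`, p35's box step at `J ≥ 1`), `state_op116_boxM`
  (p35's `state_op116_box` verbatim along `seqM`), `dip_boxState` (`(1.16)^Ω_{n,n″+1}dip` in the state `n + n″`), `dip_boxState_zero_right`
  (`(1.16)^Ω_{m+1,0}dip` in the state `m`);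
* §5 **`kernel116_mixed_box_le`**: for `n + n′ > d`, at every bond `⟨x, x+εe_μ⟩ ⊂ Ω` whose point `x` is `θL^k`-far from the face levels,
  `ε^{−d}·(ε^{−1}·Σ_i‖(D^ε_B(1.16)^Ω_{n,n′}dip^B_{⟨x′,μ′⟩}e_i)(⟨x,μ⟩)‖) ≤ mixCB(n+n′)·#Ix·(L^kε)^{n+n′}·((L^kε)^d)^{−1}·e^{−(δ^M_{n+n′−1}/2)|x−x′|/L^k}` —
  p40's binder `hM` of `B3Ineq25Op116Smooth.ineq25At_op116_smooth_of_bounds` restricted to the good bonds, the END sheet resolved by M0's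
  `face_conv_maj_le_far` with the margin at `x`.
HONEST SCOPE.  (B)-level only (the (C)-plug on cell-product boxes — p35 g21's dictionaries + `B3Op116CellBoxFaceFamily.faces_height_of_interior` — is
the one-screen sequel M3 `B3Op116MixedKernelRegularCellBox`); constants explicit (displayed `def`s with bodies), not optimized; the decay rate degrades by `4L` per insertion as in the torus
files; `d < n + n′` is print's «n, n′ sufficiently large».  No `def … : Prop`, no new named fact, no `sorry`; axioms standard.  Value = the located
non-bookkeeping step of a by-reference estimate of B3 on a box — NOT summit progress, nothing about the mass gap.
-/

noncomputable section

open scoped BigOperators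

namespace Literature.MathematicalPhysics.QuantumFieldTheory.Balaban1983to89.B3Op116MixedKernelRegularBox

open HiggsLattice (ChargeData ScalarField covDeriv)
open HiggsCovariance (propagatorK E)
open HiggsCovariancePos (Inside)
open HiggsAveraging (blockIter)
open B1Eq230FluctCov (Ix cb)
open B3Op116SourceForm (srcV covDerivAt covDerivAt_apply op116_zero_zero_apply op116_succ_left_apply op116_succ_right_apply opV_apply_eq_srcV)
open B3Op116MajorantStep (maj maj_nonneg maj_comm maj_rate_mono maj_add mul_maj maj_const_mono maj_exponent_reduce)
open B3Op116MajorantStepBoxFar (faceKfar faceKfar_nonneg face_conv_maj_le_far stepBoxCfar stepBoxCfar_nonneg stepBoxVCfar stepBoxVCfar_nonneg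
  step_fields_box_far)
open B3Op116MajorantStepBox (stepBoxC stepBoxC_nonneg stepBoxVC)
open B3Op116DKernelRegularBox (BoxState step_fields_box stepBoxVC_nonneg)
open B3Op116DKernelRegularTorus (kap4 kap4_nonneg mesh_rpow_split_one rate_div_eq)
open B3Op116CollarRowReduce (kapF kapF_nonneg)
open B3Op116CollarSources (exB enB)
open B3Eq116TwoSidedExpansion (op116 opV eq344_model eq344_model_right)
open B3Op116MajorantConvolution (majorant_le_top)
open B3Op116MixedSeed (seedK1 seedK2)
open B3Op116MixedKernelRegularTorus (cvW cdW cvW_nonneg cdW_nonneg)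
open B3Op116MixedSeedBox (pcolO pdcolO pmixO pcolO_nonneg mixed_seed_le_box value_W_dip_le_box W_dip_apply_eq_zero_of_not_mem W_apply_eq
  dcolO_le_majorant pieceR_apply_eq_zero_of_not_mem)
open B3Ineq210MixedRegularTorus (dip onb norm_onb)
open B3Ineq210RegularRegion (pieceR)

variable {P : HiggsLattice.Params} {N : ℕ}

/-! ## §1 The constants: the seed triple with its sheets, the far step, the weakened seed, the recursion -/

section Constants

/-- the differentiated-column constant `ε^dC` of the per-piece dictionary (M1's `c_{K1} = c_{K2}`). [cite: Balaban1983Higgs3, (2.10) p.426] -/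
def cK (P : HiggsLattice.Params) (Cst : ℝ) : ℝ := P.mesh 0 ^ P.d * Cst

/-- the `D^ε_B`-differentiated-column constant common to `G_k(Ω,B)` and `G_k(Ω,A+B)`: `ε^dC(1+e)` (M1's `pdcolO_cross_bound`).
[cite: Balaban1983Higgs3, (2.10) p.426] [cite: Balaban1982Higgs1, (3.14) p.614] -/
def cKe (P : HiggsLattice.Params) (Cst : ℝ) : ℝ := cK P Cst * (1 + Real.exp 1)

/-- the sheet coefficient `4dε⁻¹|e|s` of M1's row theorem. [cite: Balaban1983Higgs3, (1.16) p.414, p.433] -/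
def shC (P : HiggsLattice.Params) {N : ℕ} (C : ChargeData N) (s : ℝ) : ℝ := 4 * (P.d : ℝ) * ((P.mesh 0)⁻¹ * (|C.e| * s))

/-- the rate of the seed state: `δ_S = δ₁/(8L)` (the mixed seed's `δ₁/(4L)`, halved by the resolution of the value sheet). [cite: Balaban1983Higgs3, (2.10) p.426] -/
def seedRateB (P : HiggsLattice.Params) (δ₁ : ℝ) : ℝ := δ₁ / 2 / 2 / P.L / 2

/-- the VALUE constant of the seed `Wdip^B_{b′}e_i` on `Ω`: the torus constant `cvW` plus the resolved value sheet
`n_F·ε·#Ix·4dε⁻¹|e|s·(ε^dC)²·K_far(δ₁,1,2,θ)`. [cite: Balaban1983Higgs3, (1.16) p.414, (2.10) p.426, p.433] -/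
def cvS (P : HiggsLattice.Params) (N : ℕ) (C : ChargeData N) (k nF : ℕ) (a δ₁ Cst CM s δA θ : ℝ) : ℝ :=
  cvW P N C k a δ₁ Cst CM s δA
    + (nF : ℝ) * (P.mesh 0 * 1 * ((Fintype.card (Ix N) : ℝ) * (shC P C s * (cK P Cst * cK P Cst * faceKfar P δ₁ 1 2 θ))))

/-- the regular `D^ε_B`-ROW constant of the seed: the torus constant `cdW`. [cite: Balaban1983Higgs3, (1.16) p.414] -/
def cdS (P : HiggsLattice.Params) (N : ℕ) (C : ChargeData N) (k : ℕ) (a δ₁ Cst CM s δA : ℝ) : ℝ := cdW P N C k a δ₁ Cst CM s δA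

/-- the SHEET constant of the seed: `4dε⁻¹|e|s·c_w`, `c_w = ε·ε^dC(1+e)` the value constant of the dipole pieces. [cite: Balaban1983Higgs3, (1.16) p.414, p.433] -/
def cSS (P : HiggsLattice.Params) {N : ℕ} (C : ChargeData N) (Cst s : ℝ) : ℝ :=
  shC P C s * (P.mesh 0 * 1 * (cK P Cst * (1 + Real.exp 1)))

/-- the VALUE constant after the far step (M0 `stepBoxVCfar` at `(a_K, a_v) = (2, 2)`). [cite: Balaban1983Higgs3, (1.16) p.414, (2.10) p.426] -/
def cv1 (P : HiggsLattice.Params) (N : ℕ) (C : ChargeData N) (k nF : ℕ) (a δ₁ Cst CM s δA θ : ℝ) : ℝ :=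
  stepBoxVCfar P N k nF (seedRateB P δ₁) 2 2 (cK P Cst) (cvS P N C k nF a δ₁ Cst CM s δA θ) (cdS P N C k a δ₁ Cst CM s δA) (cSS P C Cst s)
    (cKe P Cst) (|C.e| * s) ((P.mesh 0)⁻¹ * (|C.e| * δA)) ((|C.e| * s) ^ 2) (kap4 P C k a s) (kapF P C s δA) θ

/-- the regular-derivative constant after the far step (M0 `stepBoxCfar` at `(a_K, a_v) = (1, 2)`). [cite: Balaban1983Higgs3, (1.16) p.414, (2.10) p.426] -/
def cd1 (P : HiggsLattice.Params) (N : ℕ) (C : ChargeData N) (k nF : ℕ) (a δ₁ Cst CM s δA θ : ℝ) : ℝ :=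
  stepBoxCfar P N k nF (seedRateB P δ₁) 1 2 (cKe P Cst) (cvS P N C k nF a δ₁ Cst CM s δA θ) (cdS P N C k a δ₁ Cst CM s δA) (cSS P C Cst s)
    (cKe P Cst) (|C.e| * s) ((P.mesh 0)⁻¹ * (|C.e| * δA)) ((|C.e| * s) ^ 2) (kap4 P C k a s) θ

/-- the WEAKENED seed value constant of the two inner seeds: `cvS + L^kε·cv1`. [cite: Balaban1983Higgs3, (1.16) p.414, (2.10) p.426] -/
def cvD (P : HiggsLattice.Params) (N : ℕ) (C : ChargeData N) (k nF : ℕ) (a δ₁ Cst CM s δA θ : ℝ) : ℝ :=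
  cvS P N C k nF a δ₁ Cst CM s δA θ + cv1 P N C k nF a δ₁ Cst CM s δA θ * P.mesh k

/-- the weakened regular-derivative constant: `cdS + L^kε·cd1`. [cite: Balaban1983Higgs3, (1.16) p.414, (2.10) p.426] -/
def cdD (P : HiggsLattice.Params) (N : ℕ) (C : ChargeData N) (k nF : ℕ) (a δ₁ Cst CM s δA θ : ℝ) : ℝ :=
  cdS P N C k a δ₁ Cst CM s δA + cd1 P N C k nF a δ₁ Cst CM s δA θ * P.mesh k

/-- the weakened sheet constant: `cSS + L^kε·κ_F·cvS`. [cite: Balaban1983Higgs3, (1.16) p.414, p.433] -/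
def cSD (P : HiggsLattice.Params) (N : ℕ) (C : ChargeData N) (k nF : ℕ) (a δ₁ Cst CM s δA θ : ℝ) : ℝ :=
  cSS P C Cst s + kapF P C s δA * cvS P N C k nF a δ₁ Cst CM s δA θ * P.mesh k

/-- **The recursion of the box state's constants along the insertions of (1.16), dipole seed**: state `0` = the weakened seed
`(δ_S/(4L); cvD, cdD, cSD)` (with its sheet), state `1` = M0's far step of it, state `J + 2` = p35's box step of state `J + 1`.
[cite: Balaban1983Higgs3, (1.16) p.414, (2.10) p.426, p.433] -/
def seqM (P : HiggsLattice.Params) (N : ℕ) (C : ChargeData N) (k nF : ℕ) (a δ₁ Cst CM s δA θ : ℝ) : ℕ → ℝ × ℝ × ℝ × ℝ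
  | 0 => (seedRateB P δ₁ / 2 / P.L / 2, cvD P N C k nF a δ₁ Cst CM s δA θ, cdD P N C k nF a δ₁ Cst CM s δA θ, cSD P N C k nF a δ₁ Cst CM s δA θ)
  | 1 =>
    (seedRateB P δ₁ / 2 / P.L / 2 / 2 / P.L / 2,
      stepBoxVCfar P N k nF (seedRateB P δ₁ / 2 / P.L / 2) 2 2 (cK P Cst) (cvD P N C k nF a δ₁ Cst CM s δA θ)
        (cdD P N C k nF a δ₁ Cst CM s δA θ) (cSD P N C k nF a δ₁ Cst CM s δA θ) (cKe P Cst)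
        (|C.e| * s) ((P.mesh 0)⁻¹ * (|C.e| * δA)) ((|C.e| * s) ^ 2) (kap4 P C k a s) (kapF P C s δA) θ,
      stepBoxCfar P N k nF (seedRateB P δ₁ / 2 / P.L / 2) 1 2 (cKe P Cst) (cvD P N C k nF a δ₁ Cst CM s δA θ)
        (cdD P N C k nF a δ₁ Cst CM s δA θ) (cSD P N C k nF a δ₁ Cst CM s δA θ) (cKe P Cst)
        (|C.e| * s) ((P.mesh 0)⁻¹ * (|C.e| * δA)) ((|C.e| * s) ^ 2) (kap4 P C k a s) θ,
      kapF P C s δA * cvD P N C k nF a δ₁ Cst CM s δA θ)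
  | J + 2 =>
    ((seqM P N C k nF a δ₁ Cst CM s δA θ (J + 1)).1 / 2 / P.L / 2,
      stepBoxVC P N k nF (seqM P N C k nF a δ₁ Cst CM s δA θ (J + 1)).1 2 (2 + ((J + 1 : ℕ) : ℝ)) (cK P Cst)
        (seqM P N C k nF a δ₁ Cst CM s δA θ (J + 1)).2.1 (seqM P N C k nF a δ₁ Cst CM s δA θ (J + 1)).2.2.1
        (seqM P N C k nF a δ₁ Cst CM s δA θ (J + 1)).2.2.2 (cKe P Cst)
        (|C.e| * s) ((P.mesh 0)⁻¹ * (|C.e| * δA)) ((|C.e| * s) ^ 2) (kap4 P C k a s) (kapF P C s δA),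
      stepBoxC P N k nF (seqM P N C k nF a δ₁ Cst CM s δA θ (J + 1)).1 1 (2 + ((J + 1 : ℕ) : ℝ)) (cKe P Cst)
        (seqM P N C k nF a δ₁ Cst CM s δA θ (J + 1)).2.1 (seqM P N C k nF a δ₁ Cst CM s δA θ (J + 1)).2.2.1
        (seqM P N C k nF a δ₁ Cst CM s δA θ (J + 1)).2.2.2 (cKe P Cst)
        (|C.e| * s) ((P.mesh 0)⁻¹ * (|C.e| * δA)) ((|C.e| * s) ^ 2) (kap4 P C k a s),
      kapF P C s δA * (seqM P N C k nF a δ₁ Cst CM s δA θ (J + 1)).2.1)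

/-- the rate of the state `J`. [cite: Balaban1983Higgs3, (2.10) p.426] -/
def rateM (P : HiggsLattice.Params) (N : ℕ) (C : ChargeData N) (k nF : ℕ) (a δ₁ Cst CM s δA θ : ℝ) (J : ℕ) : ℝ :=
  (seqM P N C k nF a δ₁ Cst CM s δA θ J).1

/-- the value constant of the state `J`. [cite: Balaban1983Higgs3, (1.16) p.414] -/
def cvM (P : HiggsLattice.Params) (N : ℕ) (C : ChargeData N) (k nF : ℕ) (a δ₁ Cst CM s δA θ : ℝ) (J : ℕ) : ℝ :=
  (seqM P N C k nF a δ₁ Cst CM s δA θ J).2.1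

/-- the regular-derivative constant of the state `J`. [cite: Balaban1983Higgs3, (1.16) p.414] -/
def cdM (P : HiggsLattice.Params) (N : ℕ) (C : ChargeData N) (k nF : ℕ) (a δ₁ Cst CM s δA θ : ℝ) (J : ℕ) : ℝ :=
  (seqM P N C k nF a δ₁ Cst CM s δA θ J).2.2.1

/-- the sheet constant of the state `J`. [cite: Balaban1983Higgs3, (1.16) p.414, p.433] -/
def cSM (P : HiggsLattice.Params) (N : ℕ) (C : ChargeData N) (k nF : ℕ) (a δ₁ Cst CM s δA θ : ℝ) (J : ℕ) : ℝ :=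
  (seqM P N C k nF a δ₁ Cst CM s δA θ J).2.2.2

/-- the constant of `kernel116_mixed_box_le`: `ε^{−d}·ε^{−1}·(cd_M(M−1) + n_F·cS_M(M−1)·ε^dC(1+e)·K_far(δ_{M−1},1,M,θ))/(L^{M−d} − 1)`.
[cite: Balaban1983Higgs3, (1.16) p.414] -/
def mixCB (P : HiggsLattice.Params) (N : ℕ) (C : ChargeData N) (k nF : ℕ) (a δ₁ Cst CM s δA θ : ℝ) (M : ℕ) : ℝ :=
  (P.mesh 0 ^ P.d)⁻¹ * (P.mesh 0)⁻¹ *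
    ((cdM P N C k nF a δ₁ Cst CM s δA θ (M - 1)
        + (nF : ℝ) * (cSM P N C k nF a δ₁ Cst CM s δA θ (M - 1) * cKe P Cst *
            faceKfar P (rateM P N C k nF a δ₁ Cst CM s δA θ (M - 1)) 1 (M : ℝ) θ))
      / ((P.L : ℝ) ^ ((M : ℝ) - (P.d : ℝ)) - 1))

variable {C : ChargeData N} {k nF : ℕ} {a δ₁ Cst CM s δA θ : ℝ}

/-- the recursion at `J = 0`. [cite: Balaban1983Higgs3, (2.10) p.426] -/
theorem seqM_zero :
    rateM P N C k nF a δ₁ Cst CM s δA θ 0 = seedRateB P δ₁ / 2 / P.L / 2 ∧ cvM P N C k nF a δ₁ Cst CM s δA θ 0 = cvD P N C k nF a δ₁ Cst CM s δA θ ∧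
    cdM P N C k nF a δ₁ Cst CM s δA θ 0 = cdD P N C k nF a δ₁ Cst CM s δA θ ∧ cSM P N C k nF a δ₁ Cst CM s δA θ 0 = cSD P N C k nF a δ₁ Cst CM s δA θ :=
  ⟨rfl, rfl, rfl, rfl⟩

/-- the recursion at `J = 1` (the far step). [cite: Balaban1983Higgs3, (1.16) p.414] -/
theorem seqM_one :
    rateM P N C k nF a δ₁ Cst CM s δA θ 1 = rateM P N C k nF a δ₁ Cst CM s δA θ 0 / 2 / P.L / 2 ∧
    cvM P N C k nF a δ₁ Cst CM s δA θ 1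
      = stepBoxVCfar P N k nF (rateM P N C k nF a δ₁ Cst CM s δA θ 0) 2 2 (cK P Cst) (cvM P N C k nF a δ₁ Cst CM s δA θ 0)
          (cdM P N C k nF a δ₁ Cst CM s δA θ 0) (cSM P N C k nF a δ₁ Cst CM s δA θ 0) (cKe P Cst)
          (|C.e| * s) ((P.mesh 0)⁻¹ * (|C.e| * δA)) ((|C.e| * s) ^ 2) (kap4 P C k a s) (kapF P C s δA) θ ∧
    cdM P N C k nF a δ₁ Cst CM s δA θ 1
      = stepBoxCfar P N k nF (rateM P N C k nF a δ₁ Cst CM s δA θ 0) 1 2 (cKe P Cst) (cvM P N C k nF a δ₁ Cst CM s δA θ 0)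
          (cdM P N C k nF a δ₁ Cst CM s δA θ 0) (cSM P N C k nF a δ₁ Cst CM s δA θ 0) (cKe P Cst)
          (|C.e| * s) ((P.mesh 0)⁻¹ * (|C.e| * δA)) ((|C.e| * s) ^ 2) (kap4 P C k a s) θ ∧
    cSM P N C k nF a δ₁ Cst CM s δA θ 1 = kapF P C s δA * cvM P N C k nF a δ₁ Cst CM s δA θ 0 :=
  ⟨rfl, rfl, rfl, rfl⟩

/-- the recursion at `J + 2` (p35's box step). [cite: Balaban1983Higgs3, (1.16) p.414] -/
theorem seqM_succ_succ (J : ℕ) :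
    rateM P N C k nF a δ₁ Cst CM s δA θ (J + 2) = rateM P N C k nF a δ₁ Cst CM s δA θ (J + 1) / 2 / P.L / 2 ∧
    cvM P N C k nF a δ₁ Cst CM s δA θ (J + 2)
      = stepBoxVC P N k nF (rateM P N C k nF a δ₁ Cst CM s δA θ (J + 1)) 2 (2 + ((J + 1 : ℕ) : ℝ)) (cK P Cst)
          (cvM P N C k nF a δ₁ Cst CM s δA θ (J + 1)) (cdM P N C k nF a δ₁ Cst CM s δA θ (J + 1)) (cSM P N C k nF a δ₁ Cst CM s δA θ (J + 1))
          (cKe P Cst) (|C.e| * s) ((P.mesh 0)⁻¹ * (|C.e| * δA)) ((|C.e| * s) ^ 2) (kap4 P C k a s) (kapF P C s δA) ∧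
    cdM P N C k nF a δ₁ Cst CM s δA θ (J + 2)
      = stepBoxC P N k nF (rateM P N C k nF a δ₁ Cst CM s δA θ (J + 1)) 1 (2 + ((J + 1 : ℕ) : ℝ)) (cKe P Cst)
          (cvM P N C k nF a δ₁ Cst CM s δA θ (J + 1)) (cdM P N C k nF a δ₁ Cst CM s δA θ (J + 1)) (cSM P N C k nF a δ₁ Cst CM s δA θ (J + 1))
          (cKe P Cst) (|C.e| * s) ((P.mesh 0)⁻¹ * (|C.e| * δA)) ((|C.e| * s) ^ 2) (kap4 P C k a s) ∧
    cSM P N C k nF a δ₁ Cst CM s δA θ (J + 2) = kapF P C s δA * cvM P N C k nF a δ₁ Cst CM s δA θ (J + 1) :=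
  ⟨rfl, rfl, rfl, rfl⟩

/-- `0 < δ_S ≤ δ₁/(4L) ≤ δ₁`, `δ_S ≤ δ₁/2` (`δ₁ > 0`, `L ≥ 1`). [cite: Balaban1983Higgs3, (2.10) p.426] -/
theorem seedRateB_pos_le (hδ₁ : 0 < δ₁) :
    0 < seedRateB P δ₁ ∧ seedRateB P δ₁ ≤ δ₁ / 2 / 2 / P.L ∧ seedRateB P δ₁ ≤ δ₁ / 2 ∧ seedRateB P δ₁ ≤ δ₁ := by
  have hL : (1 : ℝ) ≤ (P.L : ℝ) := by exact_mod_cast P.hL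
  have hq : 0 < δ₁ / 2 / 2 / P.L := by positivity
  have h1 : seedRateB P δ₁ ≤ δ₁ / 2 / 2 / P.L := by unfold seedRateB; linarith
  have h2 : δ₁ / 2 / 2 / P.L ≤ δ₁ / 2 / 2 := div_le_self (by positivity) hL
  have h3 : δ₁ / 2 / 2 ≤ δ₁ / 2 := by linarith
  refine ⟨by unfold seedRateB; positivity, h1, h1.trans (h2.trans h3), (h1.trans (h2.trans h3)).trans (by linarith)⟩

/-- the signs of the seed constants (`cvS, cdS, cSS, cv1, cd1, cvD, cdD, cSD ≥ 0`). [cite: Balaban1983Higgs3, (1.16) p.414] -/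
theorem seed_consts_nonneg (hL1 : 1 < P.L) (hδ₁ : 0 < δ₁) (hCst : 0 ≤ Cst) (hCM : 0 ≤ CM) (ha : 0 ≤ a) (hs : 0 ≤ s) (hδA : 0 ≤ δA)
    (hθ : 0 < θ) :
    0 ≤ cvS P N C k nF a δ₁ Cst CM s δA θ ∧ 0 ≤ cdS P N C k a δ₁ Cst CM s δA ∧ 0 ≤ cSS P C Cst s ∧
    0 ≤ cv1 P N C k nF a δ₁ Cst CM s δA θ ∧ 0 ≤ cd1 P N C k nF a δ₁ Cst CM s δA θ ∧
    0 ≤ cvD P N C k nF a δ₁ Cst CM s δA θ ∧ 0 ≤ cdD P N C k nF a δ₁ Cst CM s δA θ ∧ 0 ≤ cSD P N C k nF a δ₁ Cst CM s δA θ := by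
  have hε := P.mesh_pos 0
  have hmk := (P.mesh_pos k).le
  have hcK : 0 ≤ cK P Cst := by unfold cK; positivity
  have hcKe : 0 ≤ cKe P Cst := by unfold cKe cK; positivity
  have hsh : 0 ≤ shC P C s := by unfold shC; positivity
  have hfK : 0 ≤ faceKfar P δ₁ 1 2 θ := faceKfar_nonneg hL1 hδ₁ (by norm_num) hθ
  have hv : 0 ≤ cvS P N C k nF a δ₁ Cst CM s δA θ := by
    have h := cvW_nonneg (P := P) (N := N) (C := C) (k := k) hL1 hδ₁ hCst hCM ha hs hδA
    unfold cvS; positivity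
  have hd : 0 ≤ cdS P N C k a δ₁ Cst CM s δA := cdW_nonneg (P := P) (N := N) (C := C) (k := k) hL1 hδ₁ hCst hCM ha hs hδA
  have hS : 0 ≤ cSS P C Cst s := by unfold cSS; positivity
  obtain ⟨hr0, -, -, -⟩ := seedRateB_pos_le (P := P) hδ₁
  have hes : 0 ≤ |C.e| * s := mul_nonneg (abs_nonneg _) hs
  have hκ₂ : 0 ≤ (P.mesh 0)⁻¹ * (|C.e| * δA) := mul_nonneg (inv_nonneg.mpr hε.le) (mul_nonneg (abs_nonneg _) hδA)
  have hκ₄ : 0 ≤ kap4 P C k a s := kap4_nonneg hs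
  have hκF : 0 ≤ kapF P C s δA := kapF_nonneg hs hδA
  have hv1 : 0 ≤ cv1 P N C k nF a δ₁ Cst CM s δA θ :=
    stepBoxVCfar_nonneg hL1 k nF hr0 (by norm_num) (by norm_num) hcK hv hd hS hcKe hes hκ₂ (sq_nonneg _) hκ₄ hκF hθ
  have hd1 : 0 ≤ cd1 P N C k nF a δ₁ Cst CM s δA θ :=
    stepBoxCfar_nonneg hL1 k nF hr0 (by norm_num) (by norm_num) hcKe hv hd hS hcKe hes hκ₂ (sq_nonneg _) hκ₄ hθ
  refine ⟨hv, hd, hS, hv1, hd1, ?_, ?_, ?_⟩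
  · unfold cvD; positivity
  · unfold cdD; positivity
  · unfold cSD; positivity

/-- positivity along the recursion: `0 < δ_J ≤ δ_S/(4L)`, `cv_J, cd_J, cS_J ≥ 0`. [cite: Balaban1983Higgs3, (2.10) p.426] -/
theorem seqM_pos (hL1 : 1 < P.L) (hδ₁ : 0 < δ₁) (hCst : 0 ≤ Cst) (hCM : 0 ≤ CM) (ha : 0 ≤ a) (hs : 0 ≤ s) (hδA : 0 ≤ δA) (hθ : 0 < θ)
    (J : ℕ) :
    0 < rateM P N C k nF a δ₁ Cst CM s δA θ J ∧ rateM P N C k nF a δ₁ Cst CM s δA θ J ≤ seedRateB P δ₁ / 2 / P.L / 2 ∧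
    0 ≤ cvM P N C k nF a δ₁ Cst CM s δA θ J ∧ 0 ≤ cdM P N C k nF a δ₁ Cst CM s δA θ J ∧ 0 ≤ cSM P N C k nF a δ₁ Cst CM s δA θ J := by
  have hL : (1 : ℝ) < (P.L : ℝ) := by exact_mod_cast hL1
  have hε := P.mesh_pos 0
  have hcK : 0 ≤ cK P Cst := by unfold cK; positivity
  have hcKe : 0 ≤ cKe P Cst := by unfold cKe cK; positivity
  have hes : 0 ≤ |C.e| * s := mul_nonneg (abs_nonneg _) hs
  have hκ₂ : 0 ≤ (P.mesh 0)⁻¹ * (|C.e| * δA) := mul_nonneg (inv_nonneg.mpr hε.le) (mul_nonneg (abs_nonneg _) hδA)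
  have hκ₄ : 0 ≤ kap4 P C k a s := kap4_nonneg hs
  have hκF : 0 ≤ kapF P C s δA := kapF_nonneg hs hδA
  obtain ⟨-, -, -, -, -, hvD, hdD, hSD⟩ := seed_consts_nonneg (P := P) (N := N) (C := C) (k := k) (nF := nF) hL1 hδ₁ hCst hCM ha hs hδA hθ
  obtain ⟨hr0, -, -, -⟩ := seedRateB_pos_le (P := P) hδ₁
  have hquarter : ∀ q : ℝ, 0 < q → q / 2 / P.L / 2 ≤ q := fun q hq => by
    rw [div_div, div_div, div_le_iff₀ (by positivity)]; nlinarith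
  -- strong induction in the form `P J ∧ P (J+1)`
  have key : ∀ J, (0 < rateM P N C k nF a δ₁ Cst CM s δA θ J ∧ rateM P N C k nF a δ₁ Cst CM s δA θ J ≤ seedRateB P δ₁ / 2 / P.L / 2 ∧
      0 ≤ cvM P N C k nF a δ₁ Cst CM s δA θ J ∧ 0 ≤ cdM P N C k nF a δ₁ Cst CM s δA θ J ∧ 0 ≤ cSM P N C k nF a δ₁ Cst CM s δA θ J) ∧
      (0 < rateM P N C k nF a δ₁ Cst CM s δA θ (J + 1) ∧ rateM P N C k nF a δ₁ Cst CM s δA θ (J + 1) ≤ seedRateB P δ₁ / 2 / P.L / 2 ∧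
      0 ≤ cvM P N C k nF a δ₁ Cst CM s δA θ (J + 1) ∧ 0 ≤ cdM P N C k nF a δ₁ Cst CM s δA θ (J + 1) ∧
      0 ≤ cSM P N C k nF a δ₁ Cst CM s δA θ (J + 1)) := by
    intro J
    induction J with
    | zero =>
      obtain ⟨e1, e2, e3, e4⟩ := seqM_zero (P := P) (N := N) (C := C) (k := k) (nF := nF) (a := a) (δ₁ := δ₁) (Cst := Cst) (CM := CM)
        (s := s) (δA := δA) (θ := θ)
      obtain ⟨f1, f2, f3, f4⟩ := seqM_one (P := P) (N := N) (C := C) (k := k) (nF := nF) (a := a) (δ₁ := δ₁) (Cst := Cst) (CM := CM)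
        (s := s) (δA := δA) (θ := θ)
      have hr00 : 0 < rateM P N C k nF a δ₁ Cst CM s δA θ 0 := by rw [e1]; positivity
      refine ⟨⟨hr00, by rw [e1], by rw [e2]; exact hvD, by rw [e3]; exact hdD, by rw [e4]; exact hSD⟩, ?_, ?_, ?_, ?_, ?_⟩
      · rw [f1]; positivity
      · rw [f1, e1]; exact hquarter _ (by positivity)
      · rw [f2, e1, e2, e3, e4]
        exact stepBoxVCfar_nonneg hL1 k nF (by positivity) (by norm_num) (by norm_num) hcK hvD hdD hSD hcKe hes hκ₂ (sq_nonneg _) hκ₄ hκF hθ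
      · rw [f3, e1, e2, e3, e4]
        exact stepBoxCfar_nonneg hL1 k nF (by positivity) (by norm_num) (by norm_num) hcKe hvD hdD hSD hcKe hes hκ₂ (sq_nonneg _) hκ₄ hθ
      · rw [f4, e2]; exact mul_nonneg hκF hvD
    | succ J ih =>
      obtain ⟨-, h1, h2, h3, h4, h5⟩ := ih
      obtain ⟨g1, g2, g3, g4⟩ := seqM_succ_succ (P := P) (N := N) (C := C) (k := k) (nF := nF) (a := a) (δ₁ := δ₁) (Cst := Cst) (CM := CM)
        (s := s) (δA := δA) (θ := θ) J
      have hJ2 : (2 : ℝ) < 2 + ((J + 1 : ℕ) : ℝ) := by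
        have : (0 : ℝ) < ((J + 1 : ℕ) : ℝ) := by positivity
        linarith
      refine ⟨⟨h1, h2, h3, h4, h5⟩, ?_, ?_, ?_, ?_, ?_⟩
      · rw [g1]; positivity
      · rw [g1]; exact (hquarter _ h1).trans h2
      · rw [g2]; exact stepBoxVC_nonneg hL1 k nF h1 (by norm_num) hJ2 hcK h3 h4 h5 hcKe hes hκ₂ (sq_nonneg _) hκ₄ hκF
      · rw [g3]; exact stepBoxC_nonneg hL1 k nF h1 (by norm_num) hJ2 hcKe h3 h4 h5 hcKe hes hκ₂ (sq_nonneg _) hκ₄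
      · rw [g4]; exact mul_nonneg hκF h3
  exact (key J).1

/-- the rates are `≤ δ₁` (hence admissible for the steps). [cite: Balaban1983Higgs3, (2.10) p.426] -/
theorem rateM_le (hL1 : 1 < P.L) (hδ₁ : 0 < δ₁) (hCst : 0 ≤ Cst) (hCM : 0 ≤ CM) (ha : 0 ≤ a) (hs : 0 ≤ s) (hδA : 0 ≤ δA) (hθ : 0 < θ)
    (J : ℕ) : rateM P N C k nF a δ₁ Cst CM s δA θ J ≤ δ₁ := by
  obtain ⟨-, h, -, -, -⟩ := seqM_pos (P := P) (N := N) (C := C) (k := k) (nF := nF) hL1 hδ₁ hCst hCM ha hs hδA hθ J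
  obtain ⟨hr0, -, -, hr1⟩ := seedRateB_pos_le (P := P) hδ₁
  have hL : (1 : ℝ) ≤ (P.L : ℝ) := by exact_mod_cast P.hL
  have hq : seedRateB P δ₁ / 2 / P.L / 2 ≤ seedRateB P δ₁ := by
    rw [div_div, div_div, div_le_iff₀ (by positivity)]; nlinarith
  exact h.trans (hq.trans hr1)

end Constants

/-! ## §2 The per-piece dictionaries give the total-column dictionaries of the steps -/

section Dictionary

variable {C : ChargeData N} {Ω : Finset (HiggsLattice.Site P 0)} {B X : HiggsLattice.VecField P 0} {msq a : ℝ} {k : ℕ} {δ₁ Cst : ℝ}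

/-- **The value column of `G_k(Ω,X)` is below the sum of the value columns of its pieces** ((2.6) + triangle inequality).
[cite: Balaban1983Higgs3, (2.6) p.424] -/
theorem colO_le_sum_pcolO (hmsq : 0 < msq) (ha : 0 < a) (hL1 : 1 < P.L) (hk : 1 ≤ k) (hkK : k ≤ P.K) (x y : HiggsLattice.Site P 0) :
    ∑ i : Ix N, ‖propagatorK C Ω X msq a k (cb P N 0 (y, i)) x‖ ≤ ∑ j ∈ Finset.range k, pcolO C Ω msq a k j X x y := by
  unfold pcolO
  rw [Finset.sum_comm]
  refine Finset.sum_le_sum fun i _ => ?_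
  rw [B3Op116MixedSeedRegion.propagatorK_apply_eq_sum_piecesR C msq a k X hmsq ha hL1 hk hkK, Finset.sum_apply]
  exact norm_sum_le _ _

/-- **The value-column dictionary of the steps** from the per-piece one: `Σ_i‖(G_k(Ω,X)e_{(z,i)})(x)‖ ≤ 𝔪_k(ε^dC,2;δ₁)(x,z)` for `x ∈ Ω`.
[cite: Balaban1983Higgs3, (2.6) p.424, (2.10) p.426] -/
theorem colO_le_maj (hmsq : 0 < msq) (ha : 0 < a) (hL1 : 1 < P.L) (hk : 1 ≤ k) (hkK : k ≤ P.K) {cc : ℝ}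
    (hpc : ∀ (j : ℕ) (x : HiggsLattice.Site P 0), x ∈ Ω → ∀ y : HiggsLattice.Site P 0,
      pcolO C Ω msq a k j X x y ≤ cc * P.mesh j ^ ((2 : ℝ) - (P.d : ℝ)) *
        Real.exp (-(δ₁ * (P.mesh j)⁻¹ * (P.mesh 0 * (HiggsLattice.Site.tdist x y : ℝ)))))
    {x : HiggsLattice.Site P 0} (hx : x ∈ Ω) (z : HiggsLattice.Site P 0) :
    ∑ i : Ix N, ‖propagatorK C Ω X msq a k (cb P N 0 (z, i)) x‖ ≤ maj P k cc 2 δ₁ x z := by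
  unfold maj
  exact (colO_le_sum_pcolO hmsq ha hL1 hk hkK x z).trans (Finset.sum_le_sum fun j _ => hpc j x hx z)

/-- **The differentiated-column dictionary of the steps** from the per-piece one (M1's `dcolO_le_majorant` in the `𝔪` currency):
`Σ_i‖(D^ε_BG_k(Ω,X)e_{(z,i)})(b)‖ ≤ 𝔪_k(ε^dC,1;δ₁)(b₋,z)` at `b ⊂ Ω`. [cite: Balaban1983Higgs3, (2.6) p.424, (2.10) p.426] -/
theorem dcolO_le_maj (hmsq : 0 < msq) (ha : 0 < a) (hL1 : 1 < P.L) (hk : 1 ≤ k) (hkK : k ≤ P.K) {cc : ℝ}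
    (hpd : ∀ (j : ℕ), j < k → ∀ (b : HiggsLattice.PBond P 0), Inside Ω b → ∀ y : HiggsLattice.Site P 0,
      pdcolO C Ω msq a k j B X b y ≤ cc * P.mesh j ^ ((1 : ℝ) - (P.d : ℝ)) *
        Real.exp (-(δ₁ * (P.mesh j)⁻¹ * (P.mesh 0 * (HiggsLattice.Site.tdist b.src y : ℝ)))))
    {b : HiggsLattice.PBond P 0} (hb : Inside Ω b) (z : HiggsLattice.Site P 0) :
    ∑ i : Ix N, ‖covDeriv C B (propagatorK C Ω X msq a k (cb P N 0 (z, i))) b‖ ≤ maj P k cc 1 δ₁ b.src z := by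
  unfold maj
  refine (B3Op116MixedSeedBox.dcolO_le_sum_pdcolO B X hmsq ha hL1 hk hkK b z).trans
    (Finset.sum_le_sum fun j hj => hpd j (Finset.mem_range.1 hj) b hb z)

/-- the `D^ε_B`-differentiated-column dictionary of `G_k(Ω,X)` in the `𝔪` currency, constant weakened from `ε^dC` to `ε^dC(1+e)`.
[cite: Balaban1983Higgs3, (2.6) p.424, (2.10) p.426] -/
theorem dcol_le_cKe (hmsq : 0 < msq) (ha : 0 < a) (hL1 : 1 < P.L) (hk : 1 ≤ k) (hkK : k ≤ P.K) (hCst : 0 ≤ Cst)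
    (hpd : ∀ (j : ℕ) (b : HiggsLattice.PBond P 0), Inside Ω b → ∀ y : HiggsLattice.Site P 0,
      pdcolO C Ω msq a k j B X b y ≤ (P.mesh 0 ^ P.d * Cst) * P.mesh j ^ ((1 : ℝ) - (P.d : ℝ)) *
        Real.exp (-(δ₁ * (P.mesh j)⁻¹ * (P.mesh 0 * (HiggsLattice.Site.tdist b.src y : ℝ))))) :
    ∀ b : HiggsLattice.PBond P 0, Inside Ω b → ∀ z ∈ Ω,
      ∑ i : Ix N, ‖covDeriv C B (propagatorK C Ω X msq a k (cb P N 0 (z, i))) b‖ ≤ maj P k (cKe P Cst) 1 δ₁ b.src z := by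
  intro b hb z _
  have hcK' : 0 ≤ P.mesh 0 ^ P.d * Cst := by have := P.mesh_pos 0; positivity
  have hKKe : P.mesh 0 ^ P.d * Cst ≤ cKe P Cst := by
    unfold cKe cK; have := Real.exp_nonneg (1:ℝ); nlinarith
  exact (dcolO_le_maj (X := X) hmsq ha hL1 hk hkK (cc := P.mesh 0 ^ P.d * Cst) (fun j _ => hpd j) hb z).trans (maj_const_mono hKKe _ _)

/-- the `D^ε_B`-differentiated-column dictionary of `G_k(Ω,A+B)` in the `𝔪` currency (M1's `pdcolO_cross_bound`: `D_B = D_{A+B} + εη(e^{ieεA}−1)τ`,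
`(L^kε)|e|s ≤ 1`). [cite: Balaban1983Higgs3, (2.6) p.424, (2.10) p.426] [cite: Balaban1982Higgs1, (3.14) p.614] -/
theorem dcolAB_le_cKe {A : HiggsLattice.VecField P 0} {s : ℝ} (hmsq : 0 < msq) (ha : 0 < a) (hL1 : 1 < P.L) (hk : 1 ≤ k) (hkK : k ≤ P.K)
    (hδ₁ : 0 < δ₁) (hδ₁1 : δ₁ ≤ 1) (hCst : 0 ≤ Cst) (hs : 0 ≤ s) (ht1 : P.mesh k * (|C.e| * s) ≤ 1)
    (hpdAB : ∀ (j : ℕ) (b : HiggsLattice.PBond P 0), Inside Ω b → ∀ y : HiggsLattice.Site P 0,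
      pdcolO C Ω msq a k j (A + B) (A + B) b y ≤ (P.mesh 0 ^ P.d * Cst) * P.mesh j ^ ((1 : ℝ) - (P.d : ℝ)) *
        Real.exp (-(δ₁ * (P.mesh j)⁻¹ * (P.mesh 0 * (HiggsLattice.Site.tdist b.src y : ℝ)))))
    (hpcAB : ∀ (j : ℕ) (x : HiggsLattice.Site P 0), x ∈ Ω → ∀ y : HiggsLattice.Site P 0,
      pcolO C Ω msq a k j (A + B) x y ≤ (P.mesh 0 ^ P.d * Cst) * P.mesh j ^ ((2 : ℝ) - (P.d : ℝ)) *
        Real.exp (-(δ₁ * (P.mesh j)⁻¹ * (P.mesh 0 * (HiggsLattice.Site.tdist x y : ℝ)))))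
    (hA : ∀ b : HiggsLattice.PBond P 0, |A b| ≤ s) :
    ∀ b : HiggsLattice.PBond P 0, Inside Ω b → ∀ z ∈ Ω,
      ∑ i : Ix N, ‖covDeriv C B (propagatorK C Ω (A + B) msq a k (cb P N 0 (z, i))) b‖ ≤ maj P k (cKe P Cst) 1 δ₁ b.src z := by
  intro b hb z _
  exact dcolO_le_maj (X := A + B) hmsq ha hL1 hk hkK (cc := cKe P Cst)
    (fun j hj b hb y => by
      unfold cKe cK
      exact B3Op116MixedSeedBox.pdcolO_cross_bound hj hδ₁ hδ₁1 hCst hs ht1 hpdAB hpcAB hA hb y) hb z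

end Dictionary

/-! ## §3 The seeds: `Wdip^B_{b′}e_i` in the state `(2; δ_S; cvS, cdS, cSS)`, its far step, and both inner seeds in the state `0` of `seqM` -/

section Seeds

variable {C : ChargeData N} {Ω : Finset (HiggsLattice.Site P 0)} {A B : HiggsLattice.VecField P 0} {msq a : ℝ} {k : ℕ}
  {δ₁ Cst CM s δA : ℝ} {nF : ℕ} {F : Fin nF → Finset (HiggsLattice.Site P 0)} {ν : Fin nF → Fin P.d}
  {c : (i : Fin nF) → ZMod (P.sitesPerDir 0 (ν i))} {θ : ℝ}

/-- **(I.3.44) read from the right on `Ω`: `G_k(Ω,A+B)V_k^ΩG_k(Ω,B) = W`.** [cite: Balaban1982Higgs1, (3.44) p.619] [cite: Balaban1983Higgs3, (1.16) p.414] -/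
theorem GAB_srcV_GB_eq_box (hL1 : 1 < P.L) (hmsq : 0 < msq) (ha : 0 < a) (hk : 1 ≤ k) (ψ : ScalarField P 0 N) :
    propagatorK C Ω (A + B) msq a k (srcV C A B k Ω a (propagatorK C Ω B msq a k ψ))
      = (propagatorK C Ω (A + B) msq a k - propagatorK C Ω B msq a k) ψ := by
  have hL : (1 : ℝ) < (P.L : ℝ) := by exact_mod_cast hL1
  have hak : 0 ≤ B1.aSeq a P.L k := (B1.aSeq_pos ha hL hk).le
  have h := congrArg (fun T : Module.End ℝ (ScalarField P 0 N) => T ψ) (eq344_model_right C Ω A B a k hmsq hak)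
  simp only [LinearMap.add_apply, Module.End.mul_apply, opV_apply_eq_srcV] at h
  rw [LinearMap.sub_apply, h]
  abel

variable (hmsq : 0 < msq) (ha : 0 < a) (hL1 : 1 < P.L) (hk : 1 ≤ k) (hkK : k ≤ P.K)
  (hΩ : ∀ l, l ≤ k → ∀ x x' : HiggsLattice.Site P 0, blockIter l x = blockIter l x' → (x ∈ Ω ↔ x' ∈ Ω))
  (hδ₁ : 0 < δ₁) (hδ₁1 : δ₁ ≤ 1) (hCst : 0 ≤ Cst) (hCM : 0 ≤ CM) (hs : 0 ≤ s) (hδA : 0 ≤ δA) (ht1 : P.mesh k * (|C.e| * s) ≤ 1)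
  (hpcB : ∀ (j : ℕ) (x : HiggsLattice.Site P 0), x ∈ Ω → ∀ y : HiggsLattice.Site P 0,
    pcolO C Ω msq a k j B x y ≤ (P.mesh 0 ^ P.d * Cst) * P.mesh j ^ ((2 : ℝ) - (P.d : ℝ)) *
      Real.exp (-(δ₁ * (P.mesh j)⁻¹ * (P.mesh 0 * (HiggsLattice.Site.tdist x y : ℝ)))))
  (hpdB : ∀ (j : ℕ) (b : HiggsLattice.PBond P 0), Inside Ω b → ∀ y : HiggsLattice.Site P 0,
    pdcolO C Ω msq a k j B B b y ≤ (P.mesh 0 ^ P.d * Cst) * P.mesh j ^ ((1 : ℝ) - (P.d : ℝ)) *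
      Real.exp (-(δ₁ * (P.mesh j)⁻¹ * (P.mesh 0 * (HiggsLattice.Site.tdist b.src y : ℝ)))))
  (hpmB : ∀ (j : ℕ) (b₀ b : HiggsLattice.PBond P 0), Inside Ω b₀ → Inside Ω b →
    pmixO C Ω msq a k j B B b₀ b ≤ (P.mesh 0 ^ P.d * CM) * P.mesh j ^ ((0 : ℝ) - (P.d : ℝ)) *
      Real.exp (-(δ₁ * (P.mesh j)⁻¹ * (P.mesh 0 * (HiggsLattice.Site.tdist b₀.src b.src : ℝ)))))
  (hpcAB : ∀ (j : ℕ) (x : HiggsLattice.Site P 0), x ∈ Ω → ∀ y : HiggsLattice.Site P 0,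
    pcolO C Ω msq a k j (A + B) x y ≤ (P.mesh 0 ^ P.d * Cst) * P.mesh j ^ ((2 : ℝ) - (P.d : ℝ)) *
      Real.exp (-(δ₁ * (P.mesh j)⁻¹ * (P.mesh 0 * (HiggsLattice.Site.tdist x y : ℝ)))))
  (hpdAB : ∀ (j : ℕ) (b : HiggsLattice.PBond P 0), Inside Ω b → ∀ y : HiggsLattice.Site P 0,
    pdcolO C Ω msq a k j (A + B) (A + B) b y ≤ (P.mesh 0 ^ P.d * Cst) * P.mesh j ^ ((1 : ℝ) - (P.d : ℝ)) *
      Real.exp (-(δ₁ * (P.mesh j)⁻¹ * (P.mesh 0 * (HiggsLattice.Site.tdist b.src y : ℝ)))))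
  (hpmAB : ∀ (j : ℕ) (b₀ b : HiggsLattice.PBond P 0), Inside Ω b₀ → Inside Ω b →
    pmixO C Ω msq a k j (A + B) (A + B) b₀ b ≤ (P.mesh 0 ^ P.d * CM) * P.mesh j ^ ((0 : ℝ) - (P.d : ℝ)) *
      Real.exp (-(δ₁ * (P.mesh j)⁻¹ * (P.mesh 0 * (HiggsLattice.Site.tdist b₀.src b.src : ℝ)))))
  (hA : ∀ b : HiggsLattice.PBond P 0, |A b| ≤ s)
  (hreg : ∀ (z : HiggsLattice.Site P 0) (μ ν : Fin P.d), |A ⟨z.shift ν, μ⟩ - A ⟨z, μ⟩| ≤ δA)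
  (i₀ : Ix N) (hF : ∀ i, ∀ u ∈ F i, u (ν i) = c i)
  (hexF : ∀ b ∈ exB Ω A, ∃ i : Fin nF, b.src ∈ F i) (henF : ∀ b ∈ enB Ω A, ∃ i : Fin nF, b.tgt ∈ F i)
  (hθ : 0 < θ) {b' : HiggsLattice.PBond P 0} (hb' : Inside Ω b')
  (hfar' : ∀ i, θ * (P.L : ℝ) ^ k ≤ ((min (b'.src (ν i) - c i).val (c i - b'.src (ν i)).val : ℕ) : ℝ))
include hmsq ha hL1 hk hkK hΩ hδ₁ hδ₁1 hCst hCM hs hδA ht1 hpcB hpdB hpmB hpcAB hpdAB hpmAB hA hreg i₀ hF hexF henF hθ hb' hfar'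

omit hpcB in
/-- **THE MIXED SEED `Wdip^B_{b′}e_i` IS IN THE STATE `(2; δ_S; cvS, cdS, cSS)`** of p35's `BoxState` (anchor `b′₋`): support off `Ω` (M1
`W_dip_apply_eq_zero_of_not_mem`), values (M1 `value_W_dip_le_box`, the value sheet at the source resolved by M0's `face_conv_maj_le_far` with the
margin of `b′₋`, rates weakened to `δ_S`), derivatives at the bonds `⊂ Ω` (M1 `mixed_seed_le_box`) with the sheet `4dε⁻¹|e|s·𝔪_k(c_w,1;δ_S)(·,b′₋)`.
[cite: Balaban1983Higgs3, (1.16) p.414, (2.10) p.426, p.433] [cite: Balaban1982Higgs1, (3.44) p.619] -/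
theorem W_dip_boxState (i : Ix N) :
    BoxState C Ω B k F (cKe P Cst) b'.src 2 (seedRateB P δ₁) (cvS P N C k nF a δ₁ Cst CM s δA θ) (cdS P N C k a δ₁ Cst CM s δA) (cSS P C Cst s)
      ((propagatorK C Ω (A + B) msq a k - propagatorK C Ω B msq a k) (dip C B b' (onb N i))) := by
  have hε := P.mesh_pos 0
  have hcK : 0 ≤ cK P Cst := by unfold cK; positivity
  have hcKe : 0 ≤ cKe P Cst := by unfold cKe cK; positivity
  have hcK' : 0 ≤ P.mesh 0 ^ P.d * Cst := by positivity
  have hKKe : P.mesh 0 ^ P.d * Cst ≤ cKe P Cst := by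
    unfold cKe cK; have := Real.exp_nonneg (1:ℝ); nlinarith
  obtain ⟨hr0, hr1, hr2, hr3⟩ := seedRateB_pos_le (P := P) hδ₁
  set δS := seedRateB P δ₁ with hδS
  set φ := (propagatorK C Ω (A + B) msq a k - propagatorK C Ω B msq a k) (dip C B b' (onb N i)) with hφ
  -- the torus constants of M1's two bounds, for the unit charge
  set KV : ℝ := |C.e| * s * seedK1 P N δ₁ Cst CM a 2 (P.mesh 0 ^ P.d * Cst) ((P.mesh 0 ^ P.d * Cst) * (1 + Real.exp 1))
    + (P.L : ℝ) ^ k * (|C.e| * δA) * seedK2 P N δ₁ Cst 2 (P.mesh 0 ^ P.d * Cst) with hKV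
  set cw : ℝ := P.mesh 0 * 1 * ((P.mesh 0 ^ P.d * Cst) * (1 + Real.exp 1)) with hcw
  have hcw0 : 0 ≤ cw := by rw [hcw]; positivity
  have hKV0 : 0 ≤ KV := by
    have h1 := B3Op116MixedKernelRegularTorus.seedK1_nonneg (P := P) (N := N) hL1 hδ₁ hCst hCM ha.le two_pos hcK'
      (by positivity : 0 ≤ (P.mesh 0 ^ P.d * Cst) * (1 + Real.exp 1))
    have h2 := B3Op116MixedKernelRegularTorus.seedK2_nonneg (P := P) (N := N) hL1 hδ₁ hCst two_pos hcK'
    rw [hKV]; positivity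
  have hsh : 0 ≤ shC P C s := by unfold shC; positivity
  -- support
  have hsupp : ∀ y : HiggsLattice.Site P 0, y ∉ Ω → φ y = 0 := fun y hy =>
    W_dip_apply_eq_zero_of_not_mem hmsq ha hL1 hk hΩ hb' hy (onb N i)
  -- the sheet of the seed
  set S : HiggsLattice.Site P 0 → ℝ := fun u => shC P C s * maj P k cw 1 δS u b'.src with hSdef
  have hS0 : ∀ u, 0 ≤ S u := fun u => mul_nonneg hsh (maj_nonneg hcw0 _ _)
  have hSle : ∀ u, S u ≤ maj P k (cSS P C Cst s) (2 - 1) δS u b'.src := fun u => by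
    rw [show (2 : ℝ) - 1 = 1 by norm_num, hSdef]; simp only
    rw [mul_maj]
    unfold cSS cK
    exact le_rfl
  refine ⟨hsupp, fun y => ?_, S, fun u => ⟨hS0 u, hSle u⟩, fun b hb => ?_⟩
  · -- values
    by_cases hy : y ∈ Ω
    · have h := value_W_dip_le_box hmsq ha hL1 hk hkK hΩ hδ₁ hδ₁1 hCst hCM hs hδA ht1 hpdB hpmB hpdAB hpcAB hA hreg F hexF henF i₀ hb'
        (onb N i) hy
      rw [norm_onb, ← hKV] at h
      -- resolve the value sheet face by face, with the margin at the source `b′₋`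
      have hface : ∀ i' : Fin nF, ∑ u ∈ F i', maj P k (P.mesh 0 ^ P.d * Cst) 1 δ₁ b'.src u * maj P k (P.mesh 0 ^ P.d * Cst) 2 δ₁ u y
          ≤ maj P k (cK P Cst * cK P Cst * faceKfar P δ₁ 1 2 θ) 2 δS y b'.src := by
        intro i'
        have hswap : ∑ u ∈ F i', maj P k (P.mesh 0 ^ P.d * Cst) 1 δ₁ b'.src u * maj P k (P.mesh 0 ^ P.d * Cst) 2 δ₁ u y
            = ∑ u ∈ F i', maj P k (cK P Cst) 2 δ₁ y u * maj P k (cK P Cst) 1 δ₁ u b'.src := by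
          refine Finset.sum_congr rfl fun u _ => ?_
          unfold cK
          rw [maj_comm k _ 1 δ₁ b'.src u, maj_comm k _ 2 δ₁ u y, mul_comm]
        rw [hswap]
        have hf := face_conv_maj_le_far (P := P) (k := k) hL1 hδ₁ hδ₁1 (r := 2) (s := 1) (by norm_num) one_pos le_rfl hcK hcK hθ (hF i')
          y b'.src (hfar' i')
        rw [show (2 : ℝ) + 1 - 1 = 2 by norm_num] at hf
        exact hf.trans (maj_rate_mono (mul_nonneg (mul_nonneg hcK hcK) (faceKfar_nonneg hL1 hδ₁ (by norm_num) hθ)) hr2 _ _)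
      have hreg : maj P k KV 2 (δ₁ / 2 / 2 / P.L) b'.src y ≤ maj P k KV 2 δS y b'.src := by
        rw [maj_comm]; exact maj_rate_mono hKV0 hr1 _ _
      have hsum : ∑ i' : Fin nF, ∑ u ∈ F i', maj P k (P.mesh 0 ^ P.d * Cst) 1 δ₁ b'.src u * maj P k (P.mesh 0 ^ P.d * Cst) 2 δ₁ u y
          ≤ (nF : ℝ) * maj P k (cK P Cst * cK P Cst * faceKfar P δ₁ 1 2 θ) 2 δS y b'.src := by
        refine (Finset.sum_le_sum fun i' _ => hface i').trans (le_of_eq ?_)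
        rw [Finset.sum_const, Finset.card_univ, Fintype.card_fin, nsmul_eq_mul]
      have hIx : 0 ≤ (Fintype.card (Ix N) : ℝ) := Nat.cast_nonneg _
      have hc : P.mesh 0 * 1 * ((Fintype.card (Ix N) : ℝ) *
          (KV + 4 * (P.d : ℝ) * ((P.mesh 0)⁻¹ * (|C.e| * s)) * ((nF : ℝ) * (cK P Cst * cK P Cst * faceKfar P δ₁ 1 2 θ))))
          = cvS P N C k nF a δ₁ Cst CM s δA θ := by
        rw [hKV]; unfold cvS cvW shC; ring
      calc ‖(propagatorK C Ω (A + B) msq a k - propagatorK C Ω B msq a k) (dip C B b' (onb N i)) y‖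
          ≤ P.mesh 0 * 1 * ((Fintype.card (Ix N) : ℝ) *
              (maj P k KV 2 δS y b'.src + 4 * (P.d : ℝ) * ((P.mesh 0)⁻¹ * (|C.e| * s)) *
                ((nF : ℝ) * maj P k (cK P Cst * cK P Cst * faceKfar P δ₁ 1 2 θ) 2 δS y b'.src))) :=
            h.trans (mul_le_mul_of_nonneg_left (mul_le_mul_of_nonneg_left (add_le_add hreg
              (mul_le_mul_of_nonneg_left hsum (by positivity))) hIx) (by positivity))
        _ = maj P k (P.mesh 0 * 1 * ((Fintype.card (Ix N) : ℝ) *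
              (KV + 4 * (P.d : ℝ) * ((P.mesh 0)⁻¹ * (|C.e| * s)) * ((nF : ℝ) * (cK P Cst * cK P Cst * faceKfar P δ₁ 1 2 θ)))))
              2 δS y b'.src := by
            simp only [mul_maj, maj_add]
        _ ≤ _ := maj_const_mono (le_of_eq hc) _ _
    · rw [hsupp y hy, norm_zero]
      obtain ⟨hv, -, -, -, -, -, -, -⟩ := seed_consts_nonneg (P := P) (N := N) (C := C) (k := k) (nF := nF) hL1 hδ₁ hCst hCM ha.le hs hδA hθ
      exact maj_nonneg hv _ _
  · -- derivatives at the bonds `⊂ Ω`, with the sheet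
    have h := mixed_seed_le_box hmsq ha hL1 hk hkK hΩ hδ₁ hδ₁1 hCst hCM hs hδA ht1 hpdB hpmB hpdAB hpcAB hpmAB hA hreg F hexF henF i₀ hb hb'
      (onb N i)
    rw [norm_onb] at h
    rw [show (2 : ℝ) - 1 = 1 by norm_num]
    refine h.trans (add_le_add ?_ ?_)
    · unfold cdS cdW
      exact maj_rate_mono (cdW_nonneg (P := P) (N := N) (C := C) (k := k) hL1 hδ₁ hCst hCM ha.le hs hδA) hr1 _ _
    · rw [Finset.mul_sum]
      refine Finset.sum_le_sum fun i' _ => ?_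
      rw [Finset.mul_sum]
      refine Finset.sum_le_sum fun u _ => ?_
      rw [hSdef]; simp only
      have h1 : maj P k (P.mesh 0 ^ P.d * Cst) 1 δ₁ b.src u ≤ maj P k (cKe P Cst) 1 δS b.src u :=
        (maj_rate_mono hcK' hr3 _ _).trans (maj_const_mono hKKe _ _)
      have h2 : maj P k (P.mesh 0 * 1 * ((P.mesh 0 ^ P.d * Cst) * (1 + Real.exp 1))) 1 δ₁ u b'.src ≤ maj P k cw 1 δS u b'.src := by
        rw [← hcw]; exact maj_rate_mono hcw0 hr3 _ _
      calc 4 * (P.d : ℝ) * ((P.mesh 0)⁻¹ * (|C.e| * s)) *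
            (maj P k (P.mesh 0 ^ P.d * Cst) 1 δ₁ b.src u *
              maj P k (P.mesh 0 * 1 * ((P.mesh 0 ^ P.d * Cst) * (1 + Real.exp 1))) 1 δ₁ u b'.src)
          ≤ 4 * (P.d : ℝ) * ((P.mesh 0)⁻¹ * (|C.e| * s)) * (maj P k (cKe P Cst) 1 δS b.src u * maj P k cw 1 δS u b'.src) :=
            mul_le_mul_of_nonneg_left (mul_le_mul h1 h2 (maj_nonneg (by positivity) _ _) (maj_nonneg hcKe _ _)) (by positivity)
        _ = maj P k (cKe P Cst) 1 δS b.src u * (shC P C s * maj P k cw 1 δS u b'.src) := by unfold shC; ring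

/-- **THE FAR STEP OF THE SEED** (M0 `step_fields_box_far` at `X = B`, `(a_K, a_v) = (2, 2)`): the field `G_k(Ω,B)V_k^ΩWdip^B_{b′}e_i` — support,
values `≤ 𝔪_k(cv1, 3; δ_S/(4L))(·,b′₋)`, regular derivative rows `≤ 𝔪_k(cd1, 2; δ_S/(4L))` plus the new pending sheet `κ_F‖Wdip(u)‖` of
exponent `2`. [cite: Balaban1983Higgs3, (1.16) p.414, (2.10) p.426, p.433] [cite: Balaban1982Higgs1, (3.16) p.615] -/
theorem GB_srcV_W_dip_bounds (i : Ix N) :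
    (∀ y : HiggsLattice.Site P 0, y ∉ Ω →
      propagatorK C Ω B msq a k (srcV C A B k Ω a
        ((propagatorK C Ω (A + B) msq a k - propagatorK C Ω B msq a k) (dip C B b' (onb N i)))) y = 0) ∧
    (∀ y, ‖propagatorK C Ω B msq a k (srcV C A B k Ω a
        ((propagatorK C Ω (A + B) msq a k - propagatorK C Ω B msq a k) (dip C B b' (onb N i)))) y‖
        ≤ maj P k (cv1 P N C k nF a δ₁ Cst CM s δA θ) (2 + 2 - 1) (seedRateB P δ₁ / 2 / P.L / 2) y b'.src) ∧
    (∀ b₀ : HiggsLattice.PBond P 0, Inside Ω b₀ →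
      ‖covDeriv C B (propagatorK C Ω B msq a k (srcV C A B k Ω a
        ((propagatorK C Ω (A + B) msq a k - propagatorK C Ω B msq a k) (dip C B b' (onb N i))))) b₀‖
        ≤ maj P k (cd1 P N C k nF a δ₁ Cst CM s δA θ) (1 + 2 - 1) (seedRateB P δ₁ / 2 / P.L / 2) b₀.src b'.src
          + ∑ i' : Fin nF, ∑ u ∈ F i', maj P k (cKe P Cst) 1 (seedRateB P δ₁ / 2 / P.L / 2) b₀.src u *
              (kapF P C s δA * ‖(propagatorK C Ω (A + B) msq a k - propagatorK C Ω B msq a k) (dip C B b' (onb N i)) u‖)) ∧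
    (∀ u : HiggsLattice.Site P 0,
      0 ≤ kapF P C s δA * ‖(propagatorK C Ω (A + B) msq a k - propagatorK C Ω B msq a k) (dip C B b' (onb N i)) u‖ ∧
      kapF P C s δA * ‖(propagatorK C Ω (A + B) msq a k - propagatorK C Ω B msq a k) (dip C B b' (onb N i)) u‖
        ≤ maj P k (kapF P C s δA * cvS P N C k nF a δ₁ Cst CM s δA θ) 2 (seedRateB P δ₁ / 2 / P.L / 2) u b'.src) := by
  have hL : (1 : ℝ) < (P.L : ℝ) := by exact_mod_cast hL1
  have hak : 0 ≤ B1.aSeq a P.L k := (B1.aSeq_pos ha hL hk).le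
  have hε := P.mesh_pos 0
  have hcK : 0 ≤ cK P Cst := by unfold cK; positivity
  have hcKe : 0 ≤ cKe P Cst := by unfold cKe cK; positivity
  obtain ⟨hr0, -, -, hr3⟩ := seedRateB_pos_le (P := P) hδ₁
  obtain ⟨hv, hd, hS, -, -, -, -, -⟩ := seed_consts_nonneg (P := P) (N := N) (C := C) (k := k) (nF := nF) hL1 hδ₁ hCst hCM ha.le hs hδA hθ
  obtain ⟨hsupp, hV, S, hSb, hD⟩ := W_dip_boxState hmsq ha hL1 hk hkK hΩ hδ₁ hδ₁1 hCst hCM hs hδA ht1 hpdB hpmB hpcAB hpdAB hpmAB hA hreg i₀ hF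
    hexF henF hθ hb' hfar' i
  exact step_fields_box_far (X := B) hL1 hk hkK hmsq hak (hΩ k le_rfl) hcK hcKe
    (fun _ hx z _ => colO_le_maj (X := B) hmsq ha hL1 hk hkK hpcB hx z) (dcol_le_cKe (X := B) hmsq ha hL1 hk hkK hCst hpdB)
    hδ₁1 hs hA hδA hreg i₀ b'.src F ν c hF hexF henF hθ hfar' hr0 hr3 (by norm_num) le_rfl hv hd hS _ hsupp hV (fun _ => S)
    (fun _ u => (hSb u).1) (fun _ u => (hSb u).2) hD

omit hpcB in
/-- **THE SEED `Wdip^B_{b′}e_i` IN THE (weakened) STATE `0` of `seqM`.** [cite: Balaban1983Higgs3, (1.16) p.414, (2.10) p.426, p.433] -/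
theorem W_dip_boxStateM (i : Ix N) :
    BoxState C Ω B k F (cKe P Cst) b'.src (2 + ((0 : ℕ) : ℝ)) (rateM P N C k nF a δ₁ Cst CM s δA θ 0) (cvM P N C k nF a δ₁ Cst CM s δA θ 0)
      (cdM P N C k nF a δ₁ Cst CM s δA θ 0) (cSM P N C k nF a δ₁ Cst CM s δA θ 0)
      ((propagatorK C Ω (A + B) msq a k - propagatorK C Ω B msq a k) (dip C B b' (onb N i))) := by
  have hε := P.mesh_pos 0
  have hmk := (P.mesh_pos k).le
  have hcKe : 0 ≤ cKe P Cst := by unfold cKe cK; positivity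
  obtain ⟨e1, e2, e3, e4⟩ := seqM_zero (P := P) (N := N) (C := C) (k := k) (nF := nF) (a := a) (δ₁ := δ₁) (Cst := Cst) (CM := CM)
    (s := s) (δA := δA) (θ := θ)
  rw [e1, e2, e3, e4, Nat.cast_zero, add_zero]
  obtain ⟨hr0, -, -, -⟩ := seedRateB_pos_le (P := P) hδ₁
  obtain ⟨hv, hd, hS, hv1, hd1, -, -, -⟩ :=
    seed_consts_nonneg (P := P) (N := N) (C := C) (k := k) (nF := nF) hL1 hδ₁ hCst hCM ha.le hs hδA hθ
  have hκF : 0 ≤ kapF P C s δA := kapF_nonneg hs hδA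
  set r0 := seedRateB P δ₁ / 2 / P.L / 2 with hr0def
  have hr0S : r0 ≤ seedRateB P δ₁ := by
    rw [hr0def, div_div, div_div, div_le_iff₀ (by have := P.hL; positivity)]
    have : (1 : ℝ) ≤ (P.L : ℝ) := by exact_mod_cast P.hL
    nlinarith
  have hvD : cvS P N C k nF a δ₁ Cst CM s δA θ ≤ cvD P N C k nF a δ₁ Cst CM s δA θ := by unfold cvD; nlinarith
  have hdD : cdS P N C k a δ₁ Cst CM s δA ≤ cdD P N C k nF a δ₁ Cst CM s δA θ := by unfold cdD; nlinarith
  have hSD : cSS P C Cst s ≤ cSD P N C k nF a δ₁ Cst CM s δA θ := by unfold cSD; exact le_add_of_nonneg_right (by positivity)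
  obtain ⟨hsupp, hV, S, hSb, hD⟩ := W_dip_boxState hmsq ha hL1 hk hkK hΩ hδ₁ hδ₁1 hCst hCM hs hδA ht1 hpdB hpmB hpcAB hpdAB hpmAB hA hreg i₀ hF
    hexF henF hθ hb' hfar' i
  refine ⟨hsupp, fun y => (hV y).trans ((maj_rate_mono hv hr0S _ _).trans (maj_const_mono hvD _ _)), S,
    fun u => ⟨(hSb u).1, (hSb u).2.trans ((maj_rate_mono hS hr0S _ _).trans (maj_const_mono hSD _ _))⟩, fun b hb => ?_⟩
  refine (hD b hb).trans (add_le_add ((maj_rate_mono hd hr0S _ _).trans (maj_const_mono hdD _ _)) ?_)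
  exact Finset.sum_le_sum fun i' _ => Finset.sum_le_sum fun u _ =>
    mul_le_mul_of_nonneg_right (maj_rate_mono hcKe hr0S _ _) (hSb u).1

/-- **BOTH INNER SEEDS `G_k(Ω,X)V_k^ΩG_k(Ω,B)dip^B_{b′}e_i`, `X ∈ {B, A+B}`, ARE IN THE STATE `0` of `seqM`**: `X = A + B` gives `Wdip`
((I.3.44) from the right); `X = B` gives `Wdip − G_k(Ω,B)V_k^ΩWdip` ((I.3.44) from the left) — the seed plus its far step, exponents
reconciled by `maj_exponent_reduce`, the new pending sheet `κ_F‖Wdip(u)‖` added to the seed's sheet ((I.3.44) from the left is p40's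
`B3Op116MixedKernelRegularRegion.GB_srcV_GB_eq_region`, by name).
[cite: Balaban1983Higgs3, (1.16) p.414, (2.10) p.426, p.433] [cite: Balaban1982Higgs1, (3.44) p.619] -/
theorem seed_boxStateM (i : Ix N) (X : HiggsLattice.VecField P 0) (hX : X = B ∨ X = A + B) :
    BoxState C Ω B k F (cKe P Cst) b'.src (2 + ((0 : ℕ) : ℝ)) (rateM P N C k nF a δ₁ Cst CM s δA θ 0) (cvM P N C k nF a δ₁ Cst CM s δA θ 0)
      (cdM P N C k nF a δ₁ Cst CM s δA θ 0) (cSM P N C k nF a δ₁ Cst CM s δA θ 0)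
      (propagatorK C Ω X msq a k (srcV C A B k Ω a (propagatorK C Ω B msq a k (dip C B b' (onb N i))))) := by
  rcases hX with hX | hX <;> rw [hX]
  · -- X = B: `W dip − G_B V W dip`
    rw [B3Op116MixedKernelRegularRegion.GB_srcV_GB_eq_region hL1 hmsq ha hk]
    have hε := P.mesh_pos 0
    have hmk := (P.mesh_pos k).le
    have hcKe : 0 ≤ cKe P Cst := by unfold cKe cK; positivity
    obtain ⟨e1, e2, e3, e4⟩ := seqM_zero (P := P) (N := N) (C := C) (k := k) (nF := nF) (a := a) (δ₁ := δ₁) (Cst := Cst) (CM := CM)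
      (s := s) (δA := δA) (θ := θ)
    rw [e1, e2, e3, e4, Nat.cast_zero, add_zero]
    obtain ⟨hr0, -, -, -⟩ := seedRateB_pos_le (P := P) hδ₁
    obtain ⟨hv, hd, hS, hv1, hd1, -, -, -⟩ :=
      seed_consts_nonneg (P := P) (N := N) (C := C) (k := k) (nF := nF) hL1 hδ₁ hCst hCM ha.le hs hδA hθ
    have hκF : 0 ≤ kapF P C s δA := kapF_nonneg hs hδA
    set r0 := seedRateB P δ₁ / 2 / P.L / 2 with hr0def
    have hr00 : 0 < r0 := by rw [hr0def]; have := P.hL; positivity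
    have hr0S : r0 ≤ seedRateB P δ₁ := by
      rw [hr0def, div_div, div_div, div_le_iff₀ (by have := P.hL; positivity)]
      have : (1 : ℝ) ≤ (P.L : ℝ) := by exact_mod_cast P.hL
      nlinarith
    set φ := (propagatorK C Ω (A + B) msq a k - propagatorK C Ω B msq a k) (dip C B b' (onb N i)) with hφ
    obtain ⟨hsupp, hV, S, hSb, hD⟩ := W_dip_boxState hmsq ha hL1 hk hkK hΩ hδ₁ hδ₁1 hCst hCM hs hδA ht1 hpdB hpmB hpcAB hpdAB hpmAB hA hreg i₀
      hF hexF henF hθ hb' hfar' i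
    obtain ⟨g1, g2, g3, g4⟩ := GB_srcV_W_dip_bounds hmsq ha hL1 hk hkK hΩ hδ₁ hδ₁1 hCst hCM hs hδA ht1 hpcB hpdB hpmB hpcAB hpdAB hpmAB hA hreg
      i₀ hF hexF henF hθ hb' hfar' i
    rw [← hφ] at g1 g2 g3 g4 hsupp hV hD
    rw [← hr0def] at g2 g3 g4
    refine ⟨fun y hy => ?_, fun y => ?_, fun u => S u + kapF P C s δA * ‖φ u‖, fun u => ⟨add_nonneg (hSb u).1 (g4 u).1, ?_⟩, fun b hb => ?_⟩
    · rw [Pi.sub_apply, hsupp y hy, g1 y hy, sub_zero]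
    · rw [Pi.sub_apply]
      refine (norm_sub_le _ _).trans ?_
      have h2 := (g2 y).trans (maj_exponent_reduce (k := k) (a := 2 + 2 - 1) (δ := r0) hv1 y b'.src)
      rw [show (2 : ℝ) + 2 - 1 - 1 = 2 by norm_num] at h2
      have h1 := (hV y).trans (maj_rate_mono hv hr0S y b'.src)
      refine (add_le_add h1 h2).trans (le_of_eq ?_)
      rw [maj_add]; rfl
    · rw [show (2 : ℝ) - 1 = 1 by norm_num]
      have h1 := (hSb u).2.trans (maj_rate_mono hS hr0S u b'.src)
      rw [show (2 : ℝ) - 1 = 1 by norm_num] at h1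
      have h2 := (g4 u).2.trans (maj_exponent_reduce (k := k) (a := 2) (δ := r0) (mul_nonneg hκF hv) u b'.src)
      rw [show (2 : ℝ) - 1 = 1 by norm_num] at h2
      refine (add_le_add h1 h2).trans (le_of_eq ?_)
      rw [maj_add]; rfl
    · rw [show (2 : ℝ) - 1 = 1 by norm_num, ← covDerivAt_apply (C := C) B, map_sub]
      refine (norm_sub_le _ _).trans ?_
      rw [covDerivAt_apply, covDerivAt_apply]
      have h1 := hD b hb
      rw [show (2 : ℝ) - 1 = 1 by norm_num] at h1
      have h2 := g3 b hb
      rw [show (1 : ℝ) + 2 - 1 = 2 by norm_num] at h2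
      refine (add_le_add h1 h2).trans ?_
      have hreg1 : maj P k (cdS P N C k a δ₁ Cst CM s δA) 1 (seedRateB P δ₁) b.src b'.src
          + maj P k (cd1 P N C k nF a δ₁ Cst CM s δA θ) 2 r0 b.src b'.src ≤ maj P k (cdD P N C k nF a δ₁ Cst CM s δA θ) 1 r0 b.src b'.src := by
        have ha1 := maj_rate_mono (k := k) (a := 1) hd hr0S b.src b'.src
        have ha2 := maj_exponent_reduce (k := k) (a := 2) (δ := r0) hd1 b.src b'.src
        rw [show (2 : ℝ) - 1 = 1 by norm_num] at ha2
        refine (add_le_add ha1 ha2).trans (le_of_eq ?_)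
        rw [maj_add]; rfl
      have hsh1 : ∑ i' : Fin nF, ∑ u ∈ F i', maj P k (cKe P Cst) 1 (seedRateB P δ₁) b.src u * S u
          + ∑ i' : Fin nF, ∑ u ∈ F i', maj P k (cKe P Cst) 1 r0 b.src u * (kapF P C s δA * ‖φ u‖)
          ≤ ∑ i' : Fin nF, ∑ u ∈ F i', maj P k (cKe P Cst) 1 r0 b.src u * (S u + kapF P C s δA * ‖φ u‖) := by
        rw [← Finset.sum_add_distrib]
        refine Finset.sum_le_sum fun i' _ => ?_
        rw [← Finset.sum_add_distrib]
        refine Finset.sum_le_sum fun u _ => ?_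
        rw [mul_add]
        exact add_le_add (mul_le_mul_of_nonneg_right (maj_rate_mono hcKe hr0S _ _) (hSb u).1) le_rfl
      linarith [hreg1, hsh1]
  · -- X = A + B: `W dip`
    rw [GAB_srcV_GB_eq_box hL1 hmsq ha hk]
    exact W_dip_boxStateM hmsq ha hL1 hk hkK hΩ hδ₁ hδ₁1 hCst hCM hs hδA ht1 hpdB hpmB hpcAB hpdAB hpmAB hA hreg i₀ hF hexF henF hθ hb'
      hfar' i

end Seeds

/-! ## §4 The induction along `seqM` (the far step at `J = 0`, p35's box step at `J ≥ 1`) -/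

section Induction

variable {C : ChargeData N} {Ω : Finset (HiggsLattice.Site P 0)} {A B : HiggsLattice.VecField P 0} {msq a : ℝ} {k : ℕ}
  {δ₁ Cst CM s δA : ℝ} {nF : ℕ} {F : Fin nF → Finset (HiggsLattice.Site P 0)} {ν : Fin nF → Fin P.d}
  {c : (i : Fin nF) → ZMod (P.sitesPerDir 0 (ν i))} {θ : ℝ}

variable (hmsq : 0 < msq) (ha : 0 < a) (hL1 : 1 < P.L) (hk : 1 ≤ k) (hkK : k ≤ P.K)
  (hΩ : ∀ l, l ≤ k → ∀ x x' : HiggsLattice.Site P 0, blockIter l x = blockIter l x' → (x ∈ Ω ↔ x' ∈ Ω))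
  (hδ₁ : 0 < δ₁) (hδ₁1 : δ₁ ≤ 1) (hCst : 0 ≤ Cst) (hCM : 0 ≤ CM) (hs : 0 ≤ s) (hδA : 0 ≤ δA) (ht1 : P.mesh k * (|C.e| * s) ≤ 1)
  (hpcB : ∀ (j : ℕ) (x : HiggsLattice.Site P 0), x ∈ Ω → ∀ y : HiggsLattice.Site P 0,
    pcolO C Ω msq a k j B x y ≤ (P.mesh 0 ^ P.d * Cst) * P.mesh j ^ ((2 : ℝ) - (P.d : ℝ)) *
      Real.exp (-(δ₁ * (P.mesh j)⁻¹ * (P.mesh 0 * (HiggsLattice.Site.tdist x y : ℝ)))))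
  (hpdB : ∀ (j : ℕ) (b : HiggsLattice.PBond P 0), Inside Ω b → ∀ y : HiggsLattice.Site P 0,
    pdcolO C Ω msq a k j B B b y ≤ (P.mesh 0 ^ P.d * Cst) * P.mesh j ^ ((1 : ℝ) - (P.d : ℝ)) *
      Real.exp (-(δ₁ * (P.mesh j)⁻¹ * (P.mesh 0 * (HiggsLattice.Site.tdist b.src y : ℝ)))))
  (hpmB : ∀ (j : ℕ) (b₀ b : HiggsLattice.PBond P 0), Inside Ω b₀ → Inside Ω b →
    pmixO C Ω msq a k j B B b₀ b ≤ (P.mesh 0 ^ P.d * CM) * P.mesh j ^ ((0 : ℝ) - (P.d : ℝ)) *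
      Real.exp (-(δ₁ * (P.mesh j)⁻¹ * (P.mesh 0 * (HiggsLattice.Site.tdist b₀.src b.src : ℝ)))))
  (hpcAB : ∀ (j : ℕ) (x : HiggsLattice.Site P 0), x ∈ Ω → ∀ y : HiggsLattice.Site P 0,
    pcolO C Ω msq a k j (A + B) x y ≤ (P.mesh 0 ^ P.d * Cst) * P.mesh j ^ ((2 : ℝ) - (P.d : ℝ)) *
      Real.exp (-(δ₁ * (P.mesh j)⁻¹ * (P.mesh 0 * (HiggsLattice.Site.tdist x y : ℝ)))))
  (hpdAB : ∀ (j : ℕ) (b : HiggsLattice.PBond P 0), Inside Ω b → ∀ y : HiggsLattice.Site P 0,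
    pdcolO C Ω msq a k j (A + B) (A + B) b y ≤ (P.mesh 0 ^ P.d * Cst) * P.mesh j ^ ((1 : ℝ) - (P.d : ℝ)) *
      Real.exp (-(δ₁ * (P.mesh j)⁻¹ * (P.mesh 0 * (HiggsLattice.Site.tdist b.src y : ℝ)))))
  (hpmAB : ∀ (j : ℕ) (b₀ b : HiggsLattice.PBond P 0), Inside Ω b₀ → Inside Ω b →
    pmixO C Ω msq a k j (A + B) (A + B) b₀ b ≤ (P.mesh 0 ^ P.d * CM) * P.mesh j ^ ((0 : ℝ) - (P.d : ℝ)) *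
      Real.exp (-(δ₁ * (P.mesh j)⁻¹ * (P.mesh 0 * (HiggsLattice.Site.tdist b₀.src b.src : ℝ)))))
  (hA : ∀ b : HiggsLattice.PBond P 0, |A b| ≤ s)
  (hreg : ∀ (z : HiggsLattice.Site P 0) (μ ν : Fin P.d), |A ⟨z.shift ν, μ⟩ - A ⟨z, μ⟩| ≤ δA)
  (i₀ : Ix N) (hF : ∀ i, ∀ u ∈ F i, u (ν i) = c i)
  (hexF : ∀ b ∈ exB Ω A, ∃ i : Fin nF, b.src ∈ F i) (henF : ∀ b ∈ enB Ω A, ∃ i : Fin nF, b.tgt ∈ F i)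
  (hθ : 0 < θ) {b' : HiggsLattice.PBond P 0} (hb' : Inside Ω b')
  (hfar' : ∀ i, θ * (P.L : ℝ) ^ k ≤ ((min (b'.src (ν i) - c i).val (c i - b'.src (ν i)).val : ℕ) : ℝ))
include hmsq ha hL1 hk hkK hΩ hδ₁ hδ₁1 hCst hCM hs hδA ht1 hpcB hpdB hpmB hpcAB hpdAB hpmAB hA hreg i₀ hF hexF henF hθ hb' hfar'

omit hpmB hpmAB hb' in
/-- **THE STEP ON THE STATE along `seqM`**: if `w` is in the state `J` (exponent `2 + J`, constants `seqM J`, anchor `b′₋`), then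
`G_k(Ω,X)V_k^Ω(A,B)w` is in the state `J + 1`, for `X = B` and `X = A + B` — `J = 0`: the exponent of the sheet is `1`, and M0's
far-anchored step `step_fields_box_far` digests it by the margin of `b′₋`; `J ≥ 1`: p35's `step_fields_box`.
[cite: Balaban1983Higgs3, (1.16) p.414, (2.10) p.426, p.433] [cite: Balaban1982Higgs1, (3.16) p.615] -/
theorem step_boxStateM (J : ℕ) (w : ScalarField P 0 N)
    (hw : BoxState C Ω B k F (cKe P Cst) b'.src (2 + (J : ℝ)) (rateM P N C k nF a δ₁ Cst CM s δA θ J) (cvM P N C k nF a δ₁ Cst CM s δA θ J)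
      (cdM P N C k nF a δ₁ Cst CM s δA θ J) (cSM P N C k nF a δ₁ Cst CM s δA θ J) w)
    (X : HiggsLattice.VecField P 0) (hX : X = B ∨ X = A + B) :
    BoxState C Ω B k F (cKe P Cst) b'.src (2 + ((J + 1 : ℕ) : ℝ)) (rateM P N C k nF a δ₁ Cst CM s δA θ (J + 1))
      (cvM P N C k nF a δ₁ Cst CM s δA θ (J + 1)) (cdM P N C k nF a δ₁ Cst CM s δA θ (J + 1)) (cSM P N C k nF a δ₁ Cst CM s δA θ (J + 1))
      (propagatorK C Ω X msq a k (srcV C A B k Ω a w)) := by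
  have hL : (1 : ℝ) < (P.L : ℝ) := by exact_mod_cast hL1
  have hak : 0 ≤ B1.aSeq a P.L k := (B1.aSeq_pos ha hL hk).le
  have hε := P.mesh_pos 0
  have hcK : 0 ≤ cK P Cst := by unfold cK; positivity
  have hcKe : 0 ≤ cKe P Cst := by unfold cKe cK; positivity
  obtain ⟨hr0, -, hcv0, hcd0, hcS0⟩ := seqM_pos (P := P) (N := N) (C := C) (k := k) (nF := nF) (a := a) (δ₁ := δ₁) (Cst := Cst) (CM := CM)
    (s := s) (δA := δA) (θ := θ) hL1 hδ₁ hCst hCM ha.le hs hδA hθ J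
  have hrδ := rateM_le (P := P) (N := N) (C := C) (k := k) (nF := nF) (a := a) (δ₁ := δ₁) (Cst := Cst) (CM := CM) (s := s) (δA := δA)
    (θ := θ) hL1 hδ₁ hCst hCM ha.le hs hδA hθ J
  obtain ⟨hsupp, hV, Sf, hSf, hD⟩ := hw
  -- kernel dictionary for X
  have hcolX : ∀ x ∈ Ω, ∀ z ∈ Ω, ∑ i : Ix N, ‖propagatorK C Ω X msq a k (cb P N 0 (z, i)) x‖ ≤ maj P k (cK P Cst) 2 δ₁ x z := by
    rcases hX with hX | hX <;> rw [hX]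
    exacts [fun _ hx z _ => colO_le_maj hmsq ha hL1 hk hkK hpcB hx z, fun _ hx z _ => colO_le_maj hmsq ha hL1 hk hkK hpcAB hx z]
  have hdcolX : ∀ b : HiggsLattice.PBond P 0, Inside Ω b → ∀ z ∈ Ω,
      ∑ i : Ix N, ‖covDeriv C B (propagatorK C Ω X msq a k (cb P N 0 (z, i))) b‖ ≤ maj P k (cKe P Cst) 1 δ₁ b.src z := by
    rcases hX with hX | hX <;> rw [hX]
    exacts [dcol_le_cKe hmsq ha hL1 hk hkK hCst hpdB, dcolAB_le_cKe hmsq ha hL1 hk hkK hδ₁ hδ₁1 hCst hs ht1 hpdAB hpcAB hA]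
  have ev : (2 : ℝ) + (2 + (J : ℝ)) - 1 = 2 + ((J + 1 : ℕ) : ℝ) := by push_cast; ring
  have ed : (1 : ℝ) + (2 + (J : ℝ)) - 1 = 2 + ((J + 1 : ℕ) : ℝ) - 1 := by push_cast; ring
  have es : (2 : ℝ) + (J : ℝ) = 2 + ((J + 1 : ℕ) : ℝ) - 1 := by push_cast; ring
  rcases Nat.eq_zero_or_pos J with hJ | hJ
  · -- J = 0: the far step
    subst hJ
    obtain ⟨f1, f2, f3, f4⟩ := seqM_one (P := P) (N := N) (C := C) (k := k) (nF := nF) (a := a) (δ₁ := δ₁) (Cst := Cst) (CM := CM)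
      (s := s) (δA := δA) (θ := θ)
    have e20 : (2 : ℝ) + ((0 : ℕ) : ℝ) = 2 := by norm_num
    rw [e20] at hV hSf hD
    obtain ⟨h1, h2, h3, h4⟩ := step_fields_box_far (X := X) hL1 hk hkK hmsq hak (hΩ k le_rfl) hcK hcKe hcolX hdcolX hδ₁1 hs hA hδA hreg i₀
      b'.src F ν c hF hexF henF hθ hfar' hr0 hrδ (by norm_num : (1 : ℝ) < 2) (le_refl (2 : ℝ)) hcv0 hcd0 hcS0 w hsupp hV (fun _ => Sf)
      (fun _ u => (hSf u).1) (fun _ u => (hSf u).2) hD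
    refine ⟨h1, fun y => ?_, fun u => kapF P C s δA * ‖w u‖, fun u => ⟨(h4 u).1, ?_⟩, fun b hb => ?_⟩
    · rw [show (2 : ℝ) + ((0 + 1 : ℕ) : ℝ) = 2 + 2 - 1 by norm_num, f1, f2]; exact h2 y
    · rw [show (2 : ℝ) + ((0 + 1 : ℕ) : ℝ) - 1 = 2 by norm_num, f1, f4]; exact (h4 u).2
    · rw [show (2 : ℝ) + ((0 + 1 : ℕ) : ℝ) - 1 = 1 + 2 - 1 by norm_num, f1, f3]; exact h3 b hb
  · -- J ≥ 1: p35's box step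
    obtain ⟨m, rfl⟩ : ∃ m, J = m + 1 := ⟨J - 1, by omega⟩
    obtain ⟨g1, g2, g3, g4⟩ := seqM_succ_succ (P := P) (N := N) (C := C) (k := k) (nF := nF) (a := a) (δ₁ := δ₁) (Cst := Cst) (CM := CM)
      (s := s) (δA := δA) (θ := θ) m
    have hJ2 : (2 : ℝ) < 2 + ((m + 1 : ℕ) : ℝ) := by
      have h0J : (0 : ℝ) < ((m + 1 : ℕ) : ℝ) := by positivity
      linarith
    obtain ⟨h1, h2, h3, h4⟩ := step_fields_box (X := X) hL1 hk hkK hmsq hak (hΩ k le_rfl) hcK hcKe hcolX hdcolX hδ₁1 hs hA hδA hreg i₀ b'.src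
      F ν c hF hexF henF hr0 hrδ hJ2 hcv0 hcd0 hcS0 w hsupp hV (fun _ => Sf) (fun _ u => (hSf u).1) (fun _ u => (hSf u).2) hD
    refine ⟨h1, fun y => ?_, fun u => kapF P C s δA * ‖w u‖, fun u => ⟨(h4 u).1, ?_⟩, fun b hb => ?_⟩
    · have h := h2 y; rw [ev, ← g1, ← g2] at h; exact h
    · have h := (h4 u).2; rw [es, ← g1, ← g4] at h; exact h
    · have h := h3 b hb; rw [ed, ← g1, ← g3] at h; exact h

omit hpmB hpmAB hb' in
/-- **THE INDUCTION OVER THE INSERTIONS OF (1.16) ON `Ω` along `seqM`** (p35's `state_op116_box` verbatim): if both images `G_k(Ω,X)ψ` of a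
source `ψ` are in the state `J`, then `(1.16)^Ω_{n,n′}ψ` is in the state `J + (n + n′)`.
[cite: Balaban1983Higgs3, (1.16) p.414, (2.10) p.426, p.433] -/
theorem state_op116_boxM : ∀ (n' n J : ℕ) (ψ : ScalarField P 0 N),
    (∀ X : HiggsLattice.VecField P 0, (X = B ∨ X = A + B) →
      BoxState C Ω B k F (cKe P Cst) b'.src (2 + (J : ℝ)) (rateM P N C k nF a δ₁ Cst CM s δA θ J) (cvM P N C k nF a δ₁ Cst CM s δA θ J)
        (cdM P N C k nF a δ₁ Cst CM s δA θ J) (cSM P N C k nF a δ₁ Cst CM s δA θ J) (propagatorK C Ω X msq a k ψ)) →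
    BoxState C Ω B k F (cKe P Cst) b'.src (2 + ((J + (n + n') : ℕ) : ℝ)) (rateM P N C k nF a δ₁ Cst CM s δA θ (J + (n + n')))
      (cvM P N C k nF a δ₁ Cst CM s δA θ (J + (n + n'))) (cdM P N C k nF a δ₁ Cst CM s δA θ (J + (n + n')))
      (cSM P N C k nF a δ₁ Cst CM s δA θ (J + (n + n'))) (op116 C Ω A B msq a k n n' ψ) := by
  intro n'
  induction n' with
  | zero =>
    intro n
    induction n with
    | zero =>
      intro J ψ hψ
      have h := hψ (A + B) (Or.inr rfl)
      simp only [Nat.add_zero, op116_zero_zero_apply]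
      exact h
    | succ n ihn =>
      intro J ψ hψ
      have ih := ihn J ψ hψ
      have e : J + (n + 1 + 0) = (J + (n + 0)) + 1 := by omega
      rw [e]
      simp only [op116_succ_left_apply]
      exact step_boxStateM hmsq ha hL1 hk hkK hΩ hδ₁ hδ₁1 hCst hCM hs hδA ht1 hpcB hpdB hpcAB hpdAB hA hreg i₀ hF hexF henF hθ hfar'
        (J + (n + 0)) _ ih B (Or.inl rfl)
  | succ n' ih =>
    intro n J ψ hψ
    have hB := hψ B (Or.inl rfl)
    have hψ' : ∀ X : HiggsLattice.VecField P 0, (X = B ∨ X = A + B) →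
        BoxState C Ω B k F (cKe P Cst) b'.src (2 + ((J + 1 : ℕ) : ℝ)) (rateM P N C k nF a δ₁ Cst CM s δA θ (J + 1))
          (cvM P N C k nF a δ₁ Cst CM s δA θ (J + 1)) (cdM P N C k nF a δ₁ Cst CM s δA θ (J + 1)) (cSM P N C k nF a δ₁ Cst CM s δA θ (J + 1))
          (propagatorK C Ω X msq a k (srcV C A B k Ω a (propagatorK C Ω B msq a k ψ))) :=
      fun X hX => step_boxStateM hmsq ha hL1 hk hkK hΩ hδ₁ hδ₁1 hCst hCM hs hδA ht1 hpcB hpdB hpcAB hpdAB hA hreg i₀ hF hexF henF hθ hfar'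
        J _ hB X hX
    have h := ih n (J + 1) _ hψ'
    have e : J + (n + (n' + 1)) = J + 1 + (n + n') := by omega
    rw [e]
    simp only [op116_succ_right_apply]
    exact h

/-- **`(1.16)^Ω_{n,n″+1}dip^B_{b′}e_i` IS IN THE STATE `n + n″`** (the inner seeds of `seed_boxStateM`, then `state_op116_boxM`).
[cite: Balaban1983Higgs3, (1.16) p.414, (2.10) p.426, p.433] -/
theorem dip_boxStateM (n n'' : ℕ) (i : Ix N) :
    BoxState C Ω B k F (cKe P Cst) b'.src (2 + ((n + n'' : ℕ) : ℝ)) (rateM P N C k nF a δ₁ Cst CM s δA θ (n + n''))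
      (cvM P N C k nF a δ₁ Cst CM s δA θ (n + n'')) (cdM P N C k nF a δ₁ Cst CM s δA θ (n + n'')) (cSM P N C k nF a δ₁ Cst CM s δA θ (n + n''))
      (op116 C Ω A B msq a k n (n'' + 1) (dip C B b' (onb N i))) := by
  have h := state_op116_boxM hmsq ha hL1 hk hkK hΩ hδ₁ hδ₁1 hCst hCM hs hδA ht1 hpcB hpdB hpcAB hpdAB hA hreg i₀ hF hexF henF hθ hfar'
    n'' n 0 (srcV C A B k Ω a (propagatorK C Ω B msq a k (dip C B b' (onb N i))))
    (fun X hX => seed_boxStateM hmsq ha hL1 hk hkK hΩ hδ₁ hδ₁1 hCst hCM hs hδA ht1 hpcB hpdB hpmB hpcAB hpdAB hpmAB hA hreg i₀ hF hexF henF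
      hθ hb' hfar' i X hX)
  rw [Nat.zero_add] at h
  rw [op116_succ_right_apply]
  exact h

/-- **`(1.16)^Ω_{m+1,0}dip^B_{b′}e_i` IS IN THE STATE `m`** (`(1.16)^Ω_{1,0}dip = G_k(Ω,B)V^ΩG_k(Ω,A+B)dip = Wdip` by M1's `W_apply_eq`, then the
steps at `X = B`). [cite: Balaban1983Higgs3, (1.16) p.414, (2.10) p.426, p.433] [cite: Balaban1982Higgs1, (3.44) p.619] -/
theorem dip_boxStateM_zero_right : ∀ (m : ℕ) (i : Ix N),
    BoxState C Ω B k F (cKe P Cst) b'.src (2 + ((m : ℕ) : ℝ)) (rateM P N C k nF a δ₁ Cst CM s δA θ m)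
      (cvM P N C k nF a δ₁ Cst CM s δA θ m) (cdM P N C k nF a δ₁ Cst CM s δA θ m) (cSM P N C k nF a δ₁ Cst CM s δA θ m)
      (op116 C Ω A B msq a k (m + 1) 0 (dip C B b' (onb N i))) := by
  intro m
  induction m with
  | zero =>
    intro i
    rw [op116_succ_left_apply, op116_zero_zero_apply, ← W_apply_eq hmsq ha hL1 hk]
    exact W_dip_boxStateM hmsq ha hL1 hk hkK hΩ hδ₁ hδ₁1 hCst hCM hs hδA ht1 hpdB hpmB hpcAB hpdAB hpmAB hA hreg i₀ hF hexF henF hθ hb' hfar' i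
  | succ m ih =>
    intro i
    rw [op116_succ_left_apply]
    exact step_boxStateM hmsq ha hL1 hk hkK hΩ hδ₁ hδ₁1 hCst hCM hs hδA ht1 hpcB hpdB hpcAB hpdAB hA hreg i₀ hF hexF henF hθ hfar' m _
      (ih i) B (Or.inl rfl)

end Induction

/-! ## §5 The mixed entry of the kernel of (1.16) on `Ω` at the good bonds -/

section Kernel

variable {C : ChargeData N} {Ω : Finset (HiggsLattice.Site P 0)} {A B : HiggsLattice.VecField P 0} {msq a : ℝ} {k : ℕ}
  {δ₁ Cst CM s δA : ℝ} {nF : ℕ} {F : Fin nF → Finset (HiggsLattice.Site P 0)} {ν : Fin nF → Fin P.d}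
  {c : (i : Fin nF) → ZMod (P.sitesPerDir 0 (ν i))} {θ : ℝ}

variable (hmsq : 0 < msq) (ha : 0 < a) (hL1 : 1 < P.L) (hk : 1 ≤ k) (hkK : k ≤ P.K)
  (hΩ : ∀ l, l ≤ k → ∀ x x' : HiggsLattice.Site P 0, blockIter l x = blockIter l x' → (x ∈ Ω ↔ x' ∈ Ω))
  (hδ₁ : 0 < δ₁) (hδ₁1 : δ₁ ≤ 1) (hCst : 0 ≤ Cst) (hCM : 0 ≤ CM) (hs : 0 ≤ s) (hδA : 0 ≤ δA) (ht1 : P.mesh k * (|C.e| * s) ≤ 1)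
  (hpcB : ∀ (j : ℕ) (x : HiggsLattice.Site P 0), x ∈ Ω → ∀ y : HiggsLattice.Site P 0,
    pcolO C Ω msq a k j B x y ≤ (P.mesh 0 ^ P.d * Cst) * P.mesh j ^ ((2 : ℝ) - (P.d : ℝ)) *
      Real.exp (-(δ₁ * (P.mesh j)⁻¹ * (P.mesh 0 * (HiggsLattice.Site.tdist x y : ℝ)))))
  (hpdB : ∀ (j : ℕ) (b : HiggsLattice.PBond P 0), Inside Ω b → ∀ y : HiggsLattice.Site P 0,
    pdcolO C Ω msq a k j B B b y ≤ (P.mesh 0 ^ P.d * Cst) * P.mesh j ^ ((1 : ℝ) - (P.d : ℝ)) *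
      Real.exp (-(δ₁ * (P.mesh j)⁻¹ * (P.mesh 0 * (HiggsLattice.Site.tdist b.src y : ℝ)))))
  (hpmB : ∀ (j : ℕ) (b₀ b : HiggsLattice.PBond P 0), Inside Ω b₀ → Inside Ω b →
    pmixO C Ω msq a k j B B b₀ b ≤ (P.mesh 0 ^ P.d * CM) * P.mesh j ^ ((0 : ℝ) - (P.d : ℝ)) *
      Real.exp (-(δ₁ * (P.mesh j)⁻¹ * (P.mesh 0 * (HiggsLattice.Site.tdist b₀.src b.src : ℝ)))))
  (hpcAB : ∀ (j : ℕ) (x : HiggsLattice.Site P 0), x ∈ Ω → ∀ y : HiggsLattice.Site P 0,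
    pcolO C Ω msq a k j (A + B) x y ≤ (P.mesh 0 ^ P.d * Cst) * P.mesh j ^ ((2 : ℝ) - (P.d : ℝ)) *
      Real.exp (-(δ₁ * (P.mesh j)⁻¹ * (P.mesh 0 * (HiggsLattice.Site.tdist x y : ℝ)))))
  (hpdAB : ∀ (j : ℕ) (b : HiggsLattice.PBond P 0), Inside Ω b → ∀ y : HiggsLattice.Site P 0,
    pdcolO C Ω msq a k j (A + B) (A + B) b y ≤ (P.mesh 0 ^ P.d * Cst) * P.mesh j ^ ((1 : ℝ) - (P.d : ℝ)) *
      Real.exp (-(δ₁ * (P.mesh j)⁻¹ * (P.mesh 0 * (HiggsLattice.Site.tdist b.src y : ℝ)))))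
  (hpmAB : ∀ (j : ℕ) (b₀ b : HiggsLattice.PBond P 0), Inside Ω b₀ → Inside Ω b →
    pmixO C Ω msq a k j (A + B) (A + B) b₀ b ≤ (P.mesh 0 ^ P.d * CM) * P.mesh j ^ ((0 : ℝ) - (P.d : ℝ)) *
      Real.exp (-(δ₁ * (P.mesh j)⁻¹ * (P.mesh 0 * (HiggsLattice.Site.tdist b₀.src b.src : ℝ)))))
  (hA : ∀ b : HiggsLattice.PBond P 0, |A b| ≤ s)
  (hreg : ∀ (z : HiggsLattice.Site P 0) (μ ν : Fin P.d), |A ⟨z.shift ν, μ⟩ - A ⟨z, μ⟩| ≤ δA)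
  (i₀ : Ix N) (hF : ∀ i, ∀ u ∈ F i, u (ν i) = c i)
  (hexF : ∀ b ∈ exB Ω A, ∃ i : Fin nF, b.src ∈ F i) (henF : ∀ b ∈ enB Ω A, ∃ i : Fin nF, b.tgt ∈ F i)
  (hθ : 0 < θ)
include hmsq ha hL1 hk hkK hΩ hδ₁ hδ₁1 hCst hCM hs hδA ht1 hpcB hpdB hpmB hpcAB hpdAB hpmAB hA hreg i₀ hF hexF henF hθ

/-- **THE MIXED ENTRY OF THE KERNEL OF (1.16) ON A `k`-BLOCK UNION, NO SUPPORT CLAUSE, AT THE GOOD BONDS.**  For `n + n′ > d` and every pair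
of bonds `⟨x, x+εe_μ⟩, ⟨x′, x′+εe_{μ′}⟩ ⊂ Ω` whose points `x`, `x′` are `θL^k`-far from every face level of the family `F`,
`ε^{−d}·(ε^{−1}·Σ_i‖(D^ε_B(1.16)^Ω_{n,n′}dip^B_{⟨x′,μ′⟩}e_i)(⟨x,μ⟩)‖) ≤ mixCB(n+n′)·#Ix·(L^kε)^{n+n′}·((L^kε)^d)^{−1}·e^{−(δ^M_{n+n′−1}/2)·|x−x′|/L^k}`:
the state `n + n′ − 1` of the chain (`dip_boxStateM` / `dip_boxStateM_zero_right`), the regular part dominated by the top scale (p33's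
`majorant_le_top`, threshold `n + n′ − d > 0`), the END SHEET `Σ_iΣ_{u∈F_i}𝔪_k(ε^dC(1+e),1)(x,u)·S(u)` resolved by M0's `face_conv_maj_le_far`
with the margin of `x` — p40's binder `hM` of `B3Ineq25Op116Smooth.ineq25At_op116_smooth_of_bounds` at the good bonds, constants not optimized.
[cite: Balaban1983Higgs3, (1.16) p.414, (2.5) p.424, (2.10) p.426, p.433] [cite: Balaban1982Higgs1, Prop. 2.1 (2.25) p.610, (3.44) p.619] -/
theorem kernel116_mixed_box_le (n n' : ℕ) (hd : P.d < n + n') (μ μ' : Fin P.d) (x x' : HiggsLattice.Site P 0)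
    (hx : Inside Ω ⟨x, μ⟩) (hx' : Inside Ω ⟨x', μ'⟩)
    (hfarx : ∀ i, θ * (P.L : ℝ) ^ k ≤ ((min (x (ν i) - c i).val (c i - x (ν i)).val : ℕ) : ℝ))
    (hfarx' : ∀ i, θ * (P.L : ℝ) ^ k ≤ ((min (x' (ν i) - c i).val (c i - x' (ν i)).val : ℕ) : ℝ)) :
    (P.mesh 0 ^ P.d)⁻¹ * ((P.mesh 0)⁻¹ *
        ∑ i : Ix N, ‖covDeriv C B (op116 C Ω A B msq a k n n' (dip C B ⟨x', μ'⟩ (onb N i))) ⟨x, μ⟩‖)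
      ≤ mixCB P N C k nF a δ₁ Cst CM s δA θ (n + n') * (Fintype.card (Ix N) : ℝ) * P.mesh k ^ (n + n') * (P.mesh k ^ P.d)⁻¹ *
          Real.exp (-(rateM P N C k nF a δ₁ Cst CM s δA θ (n + n' - 1) / 2 * ((HiggsLattice.Site.tdist x x' : ℝ) / (P.L : ℝ) ^ k))) := by
  have hL : (1 : ℝ) < (P.L : ℝ) := by exact_mod_cast hL1
  have hεp := P.mesh_pos 0
  have hcK : 0 ≤ cK P Cst := by unfold cK; positivity
  have hcKe : 0 ≤ cKe P Cst := by unfold cKe cK; positivity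
  set M : ℕ := n + n' with hM
  set J : ℕ := n + n' - 1 with hJ
  have hdd := P.hd
  have hM2 : 2 ≤ M := by omega
  have hMJ : M = J + 1 := by omega
  have hMJ' : M - 1 = J := by omega
  have hJ0 : 0 < J := by omega
  have hdM : (P.d : ℝ) < (M : ℝ) := by exact_mod_cast hd
  have hsM : 0 < (M : ℝ) - (P.d : ℝ) := by linarith
  have hε : 0 ≤ (P.mesh 0 ^ P.d)⁻¹ := inv_nonneg.mpr (pow_nonneg hεp.le _)
  have hε' : 0 ≤ (P.mesh 0)⁻¹ := inv_nonneg.mpr hεp.le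
  have hsrc : (⟨x, μ⟩ : HiggsLattice.PBond P 0).src = x := rfl
  have hsrc' : (⟨x', μ'⟩ : HiggsLattice.PBond P 0).src = x' := rfl
  obtain ⟨hrJ, -, -, hcdJ, hcSJ⟩ := seqM_pos (P := P) (N := N) (C := C) (k := k) (nF := nF) (a := a) (δ₁ := δ₁) (Cst := Cst) (CM := CM)
    (s := s) (δA := δA) (θ := θ) hL1 hδ₁ hCst hCM ha.le hs hδA hθ J
  have hrJ1 : rateM P N C k nF a δ₁ Cst CM s δA θ J ≤ 1 :=
    (rateM_le (P := P) (N := N) (C := C) (k := k) (nF := nF) (a := a) (δ₁ := δ₁) (Cst := Cst) (CM := CM) (s := s) (δA := δA) (θ := θ)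
      hL1 hδ₁ hCst hCM ha.le hs hδA hθ J).trans hδ₁1
  set r := rateM P N C k nF a δ₁ Cst CM s δA θ J with hr
  set cE : ℝ := cdM P N C k nF a δ₁ Cst CM s δA θ J
    + (nF : ℝ) * (cSM P N C k nF a δ₁ Cst CM s δA θ J * cKe P Cst * faceKfar P r 1 (M : ℝ) θ) with hcE
  have hM1r : (1 : ℝ) < (M : ℝ) := by exact_mod_cast (by omega : 1 < M)
  have hfK : 0 ≤ faceKfar P r 1 (M : ℝ) θ := faceKfar_nonneg hL1 hrJ hM1r hθ
  have hcE0 : 0 ≤ cE := by rw [hcE]; positivity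
  have e2M : (2 : ℝ) + ((J : ℕ) : ℝ) - 1 = (M : ℝ) := by rw [hMJ]; push_cast; ring
  -- each `i`: the state `J` of `(1.16)_{n,n′}dip^B_{⟨x′,μ′⟩}e_i`, the end sheet resolved by the margin of `x`
  have hstate : ∀ i : Ix N, ‖covDeriv C B (op116 C Ω A B msq a k n n' (dip C B ⟨x', μ'⟩ (onb N i))) ⟨x, μ⟩‖
      ≤ maj P k cE (M : ℝ) (r / 2) x x' := by
    intro i
    have hst : BoxState C Ω B k F (cKe P Cst) x' (2 + ((J : ℕ) : ℝ)) r (cvM P N C k nF a δ₁ Cst CM s δA θ J)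
        (cdM P N C k nF a δ₁ Cst CM s δA θ J) (cSM P N C k nF a δ₁ Cst CM s δA θ J) (op116 C Ω A B msq a k n n' (dip C B ⟨x', μ'⟩ (onb N i))) := by
      cases n' with
      | zero =>
        obtain ⟨m, rfl⟩ : ∃ m, n = m + 1 := ⟨n - 1, by omega⟩
        have hJm : J = m := by omega
        have h := dip_boxStateM_zero_right hmsq ha hL1 hk hkK hΩ hδ₁ hδ₁1 hCst hCM hs hδA ht1 hpcB hpdB hpmB hpcAB hpdAB hpmAB hA hreg i₀ hF
          hexF henF hθ hx' hfarx' m i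
        rw [hr, hJm]; exact h
      | succ n'' =>
        have hJm : J = n + n'' := by omega
        have h := dip_boxStateM hmsq ha hL1 hk hkK hΩ hδ₁ hδ₁1 hCst hCM hs hδA ht1 hpcB hpdB hpmB hpcAB hpdAB hpmAB hA hreg i₀ hF hexF henF hθ
          hx' hfarx' n n'' i
        rw [hr, hJm]; exact h
    obtain ⟨-, -, S, hS, hD⟩ := hst
    have h := hD ⟨x, μ⟩ hx
    rw [hsrc, e2M] at h
    have hS' : ∀ u, 0 ≤ S u ∧ S u ≤ maj P k (cSM P N C k nF a δ₁ Cst CM s δA θ J) (M : ℝ) r u x' := fun u => by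
      have h := hS u; rw [e2M] at h; exact h
    have hr2 : r / 2 ≤ r := by linarith
    -- the end sheet, face by face
    have hface : ∀ i' : Fin nF, ∑ u ∈ F i', maj P k (cKe P Cst) 1 r x u * S u
        ≤ maj P k (cSM P N C k nF a δ₁ Cst CM s δA θ J * cKe P Cst * faceKfar P r 1 (M : ℝ) θ) (M : ℝ) (r / 2) x x' := by
      intro i'
      have hle : ∑ u ∈ F i', maj P k (cKe P Cst) 1 r x u * S u
          ≤ ∑ u ∈ F i', maj P k (cSM P N C k nF a δ₁ Cst CM s δA θ J) (M : ℝ) r x' u * maj P k (cKe P Cst) 1 r u x := by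
        refine Finset.sum_le_sum fun u _ => ?_
        rw [maj_comm k _ 1 r x u, maj_comm k _ _ r x' u, mul_comm]
        exact mul_le_mul_of_nonneg_right (hS' u).2 (maj_nonneg hcKe _ _)
      refine hle.trans ?_
      have hf := face_conv_maj_le_far (P := P) (k := k) hL1 hrJ hrJ1 (r := (M : ℝ)) (s := 1) hM1r one_pos le_rfl hcSJ hcKe hθ
        (hF i') x' x (hfarx i')
      rw [show (M : ℝ) + 1 - 1 = (M : ℝ) by ring, maj_comm] at hf
      exact hf
    have hsum : ∑ i' : Fin nF, ∑ u ∈ F i', maj P k (cKe P Cst) 1 r x u * S u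
        ≤ (nF : ℝ) * maj P k (cSM P N C k nF a δ₁ Cst CM s δA θ J * cKe P Cst * faceKfar P r 1 (M : ℝ) θ) (M : ℝ) (r / 2) x x' := by
      refine (Finset.sum_le_sum fun i' _ => hface i').trans (le_of_eq ?_)
      rw [Finset.sum_const, Finset.card_univ, Fintype.card_fin, nsmul_eq_mul]
    have hregp : maj P k (cdM P N C k nF a δ₁ Cst CM s δA θ J) (M : ℝ) r x x'
        ≤ maj P k (cdM P N C k nF a δ₁ Cst CM s δA θ J) (M : ℝ) (r / 2) x x' := maj_rate_mono hcdJ hr2 _ _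
    refine h.trans ((add_le_add hregp hsum).trans (le_of_eq ?_))
    rw [hcE, mul_maj, maj_add]
  -- the top-scale domination (p33's `majorant_le_top`, threshold `M − d > 0`)
  have hpt : ∀ i : Ix N, ‖covDeriv C B (op116 C Ω A B msq a k n n' (dip C B ⟨x', μ'⟩ (onb N i))) ⟨x, μ⟩‖
      ≤ cE / ((P.L : ℝ) ^ ((M : ℝ) - (P.d : ℝ)) - 1) * P.mesh k ^ ((M : ℝ) - (P.d : ℝ)) *
          Real.exp (-(r / 2 * (P.mesh k)⁻¹ * (P.mesh 0 * (HiggsLattice.Site.tdist x x' : ℝ)))) := by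
    intro i
    refine (hstate i).trans ?_
    unfold maj
    exact majorant_le_top hL1 hcE0 hsM (by linarith) x x'
  have hsplit : P.mesh k ^ ((M : ℝ) - (P.d : ℝ)) = P.mesh k ^ M * (P.mesh k ^ P.d)⁻¹ := by
    have h := B3Op116DKernelRegularTorus.mesh_rpow_split (P := P) (k := k) 0 M
    simp only [Nat.cast_zero, zero_add, pow_zero, one_mul] at h
    exact h
  have hmix : mixCB P N C k nF a δ₁ Cst CM s δA θ M = (P.mesh 0 ^ P.d)⁻¹ * (P.mesh 0)⁻¹ * (cE / ((P.L : ℝ) ^ ((M : ℝ) - (P.d : ℝ)) - 1)) := by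
    rw [hcE, hr]
    unfold mixCB rateM
    rw [hMJ']
  calc (P.mesh 0 ^ P.d)⁻¹ * ((P.mesh 0)⁻¹ *
        ∑ i : Ix N, ‖covDeriv C B (op116 C Ω A B msq a k n n' (dip C B ⟨x', μ'⟩ (onb N i))) ⟨x, μ⟩‖)
      ≤ (P.mesh 0 ^ P.d)⁻¹ * ((P.mesh 0)⁻¹ * ∑ _i : Ix N,
          cE / ((P.L : ℝ) ^ ((M : ℝ) - (P.d : ℝ)) - 1) * P.mesh k ^ ((M : ℝ) - (P.d : ℝ)) *
            Real.exp (-(r / 2 * (P.mesh k)⁻¹ * (P.mesh 0 * (HiggsLattice.Site.tdist x x' : ℝ))))) :=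
        mul_le_mul_of_nonneg_left (mul_le_mul_of_nonneg_left (Finset.sum_le_sum fun i _ => hpt i) hε') hε
    _ = _ := by
        rw [Finset.sum_const, Finset.card_univ, nsmul_eq_mul, hsplit, hmix]
        rw [show r / 2 * (P.mesh k)⁻¹ * (P.mesh 0 * (HiggsLattice.Site.tdist x x' : ℝ))
          = r / 2 * ((HiggsLattice.Site.tdist x x' : ℝ) / (P.L : ℝ) ^ k) from rate_div_eq (k := k) (r / 2) x x']
        ring

end Kernel

end Literature.MathematicalPhysics.QuantumFieldTheory.Balaban1983to89.B3Op116MixedKernelRegularBox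

end
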